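import Literature.NumberTheory.LFunctions.Zhang2022.DetectorShiftBulkSymbol
import Literature.NumberTheory.LFunctions.Zhang2022.DetectorShiftClosedForm
import Literature.Analysis.Fourier.HalfPeriodParseval

/-!
# Zhang (2022), programme F-S3 (cell landau-siegel §E, E-102 head 2 / E-010(ii), DOUBLING route piece [K3]):
# full-circle Parseval for the bulk form on the DOUBLED interval `[−1,0] ∪ [0,1]` —
# `T_b^{[−1,0]}(S_L) + T_b^{[0,1]}(S_R) = (π⁴/2)·Σ_{m∈ℤ} σ_b(m)·|D(m)|²` for `C¹`-glued, piecewise-`H²`, doubly clamped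
# data, hence `≥ 0` whenever the lattice symbol `σ_b(m) = m(m+b₀)(m+b₁)(m+b₂)` is `≥ 0` on `ℤ`

Y. Zhang, *Discrete mean estimates and the Landau–Siegel zero*, arXiv:2211.02515v1 [Zhang2022LandauSiegel] —
an unrefereed manuscript under adjudication. **WHAT THIS IS NOT: not a claim about Theorems 1–2 of
arXiv:2211.02515, about Landau–Siegel zeros, about a repaired `Margin232`, or about Parity; nothing here asserts the
row E-102 (`Det.EdetPremise`), its head 2 `Det.MonomialConePSD`, the E-010 slot, or `Det.FormDetPSD` of any recipe.
The programme SEARCHES and TYPES; no claim about Landau–Siegel zeros, Theorems 1–2 of arXiv:2211.02515 or a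
repaired Margin232 until a kernel theorem says so.**

CONTEXT (ls-barrier-plan g1, E-102 pen, 2026-08-27T01:45:23Z «KERNEL PLAN OF RECORD = DOUBLING»; theory g2
01:58:50Z): with `S = ∫_y^1 g` (K1, `DetectorShiftClosedForm`: `(π/2)·𝔅_{R(b)}(g) = c₀(b)·T_b^{[0,1]}(S) +
freeEnd_b(S(0), S′(0))`) and the clamped extremal `S_L` on `[−1,0]` whose bulk energy is the free-end form (K2,
`DetectorDoublingIdentity`), `(π/2)·𝔅 = c₀·[T^{[−1,0]}(S_L) + T^{[0,1]}(S)]`; THIS piece (K3) shows that the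
bracket is `≥ 0` for EVERY `C¹`-glued, piecewise-`H²`, doubly clamped pair whenever `σ_b ≥ 0` on `ℤ` — for
sign-admissible `b` that is `SignAdmissible.bulkSymbol_intCast_nonneg` (p482386) — by Parseval on the circle of
length `2` and two integrations by parts per piece (boundary terms cancel at the glue point by the `C¹` matching, at
`±1` by the clamps, and because `e^{−iπm·1} = e^{−iπm·(−1)}`).

THIS FILE (0 facts; three `Prop`s DEFINED AND PROVED here, net debt 0):
* (imported) `Det.bulkFormOn b a c S S′ S″` — the bulk form `T_b` on `[a, c]` in the tail-primitive variable
  (`DetectorShiftClosedForm`, ls-barrier-p2 g3 p485967; ls-barrier-num g2's ShadowKernelSketch.lean 1268210b689bb6c5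
  l.144 verbatim);
* `Det.dpiece a c S m = ∫_a^c S(y)e^{−iπmy} dy`, the per-piece integration-by-parts rule `dpiece_deriv`, the glued
  transform and the polarised Parseval identity on the period cell `(−1, 1]` in the `MemLp` shape
  (`hasSum_conj_glue_mul`, from `Literature.Analysis.Fourier.hasSum_conj_fourierCoeffOn_mul`, ls-Bdet-num-1 g4 p484598,
  [Katznelson2004, Ch. I §5]);
* **`Det.hasSum_bulkFormOn_two_piece`** — the diagonalisation
  `HasSum (m ↦ (π⁴/2)·(m⁴ + e₁m³ + e₂m² + e₃m)·|D(m)|²) (T_b^{[−1,0]}(S_L) + T_b^{[0,1]}(S_R))`;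
* **`Det.DoubledBulkNonnegTwoPiece b`** (the shape K6 consumes: hypotheses = continuity of `S, S′` on each closed
  piece, RIGHT-derivatives `S → S′ → S″` on each OPEN piece, `S″ ∈ L²` on each piece, clamps at `±1`, `C¹` matching
  at `0`, `σ_b ≥ 0` on `ℤ` as `∀ m, 0 ≤ bulkSymbol b m`) with **`Det.doubledBulkNonnegTwoPiece b`** PROVED for every
  `b`, and `bulkFormOn_two_piece_nonneg_of_signAdmissible`;
* **`Det.DoubledBulkNonneg b`** (ls-barrier-num's one-piece statement shape, sketch l.194, VERBATIM) with
  **`Det.doubledBulkNonneg b`** PROVED (the one-piece case `S_L = S_R = S`);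
* the adapter `hasDerivWithinAt_Ioi_of_integral_repr` («FTC line» with a continuous integrand ⇒ right-derivative
  on the open piece), so that statement shapes written with integral representations (K2/K6 sketches) feed
  `DoubledBulkNonnegTwoPiece` directly;
* Part 6 `rightPiece_of_kinked` (the right piece `tailPrim g, −g, −g′` of a one-sided kinked profile satisfies the
  hypotheses) and **`bulkFormOn_doubled_nonneg_of_kinked`** — the glued corollary K6 consumes: sign-admissible `b`,
  kinked one-sided `g`, any left piece in the K2 shape (continuous `S_L, S_L′, S_L″`, FTC lines, clamps at `−1`,
  matching `S_L(0) = ∫₀¹g`, `S_L′(0) = −g(0)`) ⇒ `0 ≤ T^{[−1,0]}(S_L) + T^{[0,1]}(tailPrim g)`;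
* Part 7 ([K3′], appended): **Parseval on the circle with finitely many kinks** — ONE function on any period cell
  `[c, c+2]`, right-derivatives outside a finite node set `N`, periodic `C¹` matching, no clamps:
  `dpiece_deriv_of_finset` (IBP, boundary terms telescope), `hasSum_conj_dpiece_cell_mul`, `dcell_deriv`,
  `bulkFormOn_add_adjacent` (T^{[a,d]} = T^{[a,x]} + T^{[x,d]}),
  **`hasSum_bulkFormOn_circle`**, `Det.CircleBulkNonneg b` + **`circleBulkNonneg b`** PROVED ∀ b,
  `bulkFormOn_circle_nonneg_of_signAdmissible` (the Parseval input of the two-sided doubling identity).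

Elementary real analysis; standard axioms. Cell landau-siegel, ls-Bmulti-typer-2 g3 (CLAIM [K3] 2026-08-27T01:52:46Z;
export shape 02:09:26Z), reader ls-Bdet-typer-2 g2.

References: Y. Zhang, arXiv:2211.02515v1 (2022), Prop. 7.1 p.44 with (7.2), §8 (8.11)–(8.23) [pp. 44–50];
Y. Katznelson, *An introduction to harmonic analysis*, 3rd ed. (2004), Ch. I §5 (Parseval) [Katznelson2004];
barrier/num/SHIFT-PSD.md and H-CLOSED-FORM.md §10 (ls-barrier-num, cell-internal).
[cite: Zhang2022LandauSiegel, Prop 7.1 p.44 with (7.2), (8.11)–(8.23)]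
-/

noncomputable section

open Complex Real Set intervalIntegral Filter Topology
open _root_.MeasureTheory
open scoped ComplexConjugate

namespace Literature.NumberTheory.LFunctions.Zhang2022

open Repair

namespace Det

variable {b : Fin 3 → ℝ}

/-! ### Part 1 — the per-piece transform (the bulk form `Det.bulkFormOn` is imported from `DetectorShiftClosedForm`) -/

/-- The per-piece transform `∫_a^c S(y)·e^{−iπmy} dy`. [cite: Zhang2022LandauSiegel, Prop 7.1 p.44 with (7.2), (8.11)–(8.23)] -/
def dpiece (a c : ℝ) (S : ℝ → ℂ) (m : ℤ) : ℂ := ∫ y in a..c, S y * cexp (-(I * π * m * y))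

/-! ### Part 2 — square-integrable and continuous data on an interval -/

section Interval

variable {a c : ℝ} {u v : ℝ → ℂ}

/-- A function continuous on `[a,c]` is square-integrable on `(a,c]`. [cite: Zhang2022LandauSiegel, Prop 7.1 p.44 with (7.2), (8.11)–(8.23)] -/
theorem memLp_two_of_continuousOn_Icc' (hu : ContinuousOn u (Icc a c)) : MemLp u 2 (volume.restrict (Ioc a c)) := by
  obtain ⟨C, hC⟩ := isCompact_Icc.exists_bound_of_continuousOn hu
  refine MemLp.of_bound ((hu.mono Ioc_subset_Icc_self).aestronglyMeasurable measurableSet_Ioc) C ?_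
  filter_upwards [ae_restrict_mem measurableSet_Ioc] with y hy
  exact hC y (Ioc_subset_Icc_self hy)

/-- `L²(a,c] ⊂ L¹`: interval integrability. [cite: Zhang2022LandauSiegel, Prop 7.1 p.44 with (7.2), (8.11)–(8.23)] -/
theorem intervalIntegrable_of_memLp_Ioc (hac : a ≤ c) (hu : MemLp u 2 (volume.restrict (Ioc a c))) :
    IntervalIntegrable u volume a c := by
  rw [intervalIntegrable_iff_integrableOn_Ioc_of_le hac]
  exact hu.integrable one_le_two

/-- `conj u · v` is interval integrable for `u` continuous and `v` square-integrable.
[cite: Zhang2022LandauSiegel, Prop 7.1 p.44 with (7.2), (8.11)–(8.23)] -/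
theorem intervalIntegrable_conj_mul_of_continuousOn_of_memLp' (hac : a ≤ c) (hu : ContinuousOn u (Icc a c))
    (hv : MemLp v 2 (volume.restrict (Ioc a c))) :
    IntervalIntegrable (fun y => conj (u y) * v y) volume a c := by
  rw [intervalIntegrable_iff_integrableOn_Ioc_of_le hac]
  obtain ⟨C, hC⟩ := isCompact_Icc.exists_bound_of_continuousOn hu
  have hmeas : AEStronglyMeasurable (fun y => conj (u y)) (volume.restrict (Ioc a c)) :=
    (Complex.continuous_conj.comp_continuousOn (hu.mono Ioc_subset_Icc_self)).aestronglyMeasurable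
      measurableSet_Ioc
  refine Integrable.bdd_mul (c := C) (hv.integrable one_le_two) hmeas ?_
  filter_upwards [ae_restrict_mem measurableSet_Ioc] with y hy
  rw [Complex.norm_conj]
  exact hC y (Ioc_subset_Icc_self hy)

/-- `conj u · u` is interval integrable for square-integrable `u`. [cite: Zhang2022LandauSiegel, Prop 7.1 p.44 with (7.2), (8.11)–(8.23)] -/
theorem intervalIntegrable_conj_mul_self_of_memLp' (hac : a ≤ c) (hu : MemLp u 2 (volume.restrict (Ioc a c))) :
    IntervalIntegrable (fun y => conj (u y) * u y) volume a c := by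
  rw [intervalIntegrable_iff_integrableOn_Ioc_of_le hac]
  have hint : Integrable (fun y => ‖u y‖ ^ 2) (volume.restrict (Ioc a c)) :=
    (memLp_two_iff_integrable_sq_norm hu.1).1 hu
  have hC := Complex.ofRealCLM.integrable_comp hint
  refine hC.congr ?_
  filter_upwards with y
  simp only [Complex.ofRealCLM_apply, Complex.conj_mul', Complex.ofReal_pow]

/-- **Adapter (integral representation ⇒ right-derivative)**: if `f` is continuous on `[a,c]` and
`F(y) = F(a) + ∫_a^y f` on `[a,c]`, then `F` has right-derivative `f(y)` at every interior point (FTC-1). This turns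
the «FTC lines» of the K2/K6 statement shapes (ls-Bdet-typer-2 g2's K6 sketch 155ebc5acde57ea1) into the
right-derivative hypotheses of `DoubledBulkNonnegTwoPiece`. [cite: Zhang2022LandauSiegel, Prop 7.1 p.44 with (7.2), (8.11)–(8.23)] -/
theorem hasDerivWithinAt_Ioi_of_integral_repr {F f : ℝ → ℂ} (hf : ContinuousOn f (Icc a c))
    (hF : ∀ y ∈ Icc a c, F y = F a + ∫ t in a..y, f t) :
    ∀ y ∈ Ioo a c, HasDerivWithinAt F (f y) (Ioi y) y := by
  intro y hy
  have hopen : IsOpen (Ioo a c) := isOpen_Ioo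
  have hcont : ContinuousOn f (Ioo a c) := hf.mono Ioo_subset_Icc_self
  have hint : IntervalIntegrable f volume a y :=
    (hf.mono (by rw [uIcc_of_le hy.1.le]; exact Icc_subset_Icc_right hy.2.le)).intervalIntegrable
  have hmeas : StronglyMeasurableAtFilter f (𝓝 y) volume := hcont.stronglyMeasurableAtFilter hopen y hy
  have hcy : ContinuousAt f y := hcont.continuousAt (hopen.mem_nhds hy)
  have hG : HasDerivAt (fun u => F a + ∫ t in a..u, f t) (f y) y := by
    simpa using (intervalIntegral.integral_hasDerivAt_right hint hmeas hcy).const_add (F a)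
  have heq : (fun u => F a + ∫ t in a..u, f t) =ᶠ[𝓝 y] F := by
    filter_upwards [hopen.mem_nhds hy] with u hu
    exact (hF u (Ioo_subset_Icc_self hu)).symm
  exact (hG.congr_of_eventuallyEq heq.symm).hasDerivWithinAt

/-- The kernel `k_m(y) = e^{−iπmy}` and its derivative. [cite: Zhang2022LandauSiegel, Prop 7.1 p.44 with (7.2), (8.11)–(8.23)] -/
theorem hasDerivAt_dker (m : ℤ) (y : ℝ) :
    HasDerivAt (fun y : ℝ => cexp (-(I * π * m * y))) (-(I * π * m) * cexp (-(I * π * m * y))) y := by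
  have hlin : HasDerivAt (fun y : ℝ => -(I * π * m * (y : ℂ))) (-(I * π * m * 1)) y :=
    (((hasDerivAt_id y).ofReal_comp).const_mul (I * π * m)).neg
  have := hlin.cexp
  simp only [mul_one] at this
  refine this.congr_deriv ?_
  ring

/-- The kernel is `2`-periodic at the integer frequencies: `k_m(1) = k_m(−1)`.
[cite: Zhang2022LandauSiegel, Prop 7.1 p.44 with (7.2), (8.11)–(8.23)] -/
theorem dker_one_eq_dker_neg_one (m : ℤ) :
    cexp (-(I * π * m * ((1:ℝ) : ℂ))) = cexp (-(I * π * m * ((-1:ℝ) : ℂ))) := by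
  rw [Complex.exp_eq_exp_iff_exists_int]
  refine ⟨-m, ?_⟩
  push_cast
  ring

/-- **Integration by parts on one piece**: for `S` continuous on `[a,c]` with right-derivative `S′` on `(a,c)`
(interval integrable), `∫_a^c S′k_m = S(c)k_m(c) − S(a)k_m(a) + iπm·∫_a^c S k_m`.
[cite: Zhang2022LandauSiegel, Prop 7.1 p.44 with (7.2), (8.11)–(8.23)] -/
theorem dpiece_deriv (hac : a ≤ c) {S S' : ℝ → ℂ} (hS : ContinuousOn S (Icc a c))
    (hSS' : ∀ y ∈ Ioo a c, HasDerivWithinAt S (S' y) (Ioi y) y) (hS'i : IntervalIntegrable S' volume a c) (m : ℤ) :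
    dpiece a c S' m = S c * cexp (-(I * π * m * (c : ℂ))) - S a * cexp (-(I * π * m * (a : ℂ)))
      + I * π * m * dpiece a c S m := by
  have hk : Continuous fun y : ℝ => cexp (-(I * π * m * y)) := by fun_prop
  have hk' : Continuous fun y : ℝ => -(I * π * m) * cexp (-(I * π * m * y)) := by fun_prop
  have ibp := intervalIntegral.integral_deriv_mul_eq_sub_of_hasDeriv_right
    (u := S) (v := fun y : ℝ => cexp (-(I * π * m * y))) (u' := S')
    (v' := fun y : ℝ => -(I * π * m) * cexp (-(I * π * m * y))) (a := a) (b := c)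
    (by rwa [uIcc_of_le hac]) hk.continuousOn
    (by
      intro y hy
      rw [min_eq_left hac, max_eq_right hac] at hy
      exact hSS' y hy)
    (fun y _ => (hasDerivAt_dker m y).hasDerivWithinAt) hS'i (hk'.intervalIntegrable _ _)
  have i1 : IntervalIntegrable (fun y => S' y * cexp (-(I * π * m * y))) volume a c :=
    hS'i.mul_continuousOn hk.continuousOn
  have i2 : IntervalIntegrable (fun y => S y * (-(I * π * m) * cexp (-(I * π * m * y)))) volume a c :=
    (hS.intervalIntegrable_of_Icc hac).mul_continuousOn hk'.continuousOn
  rw [intervalIntegral.integral_add i1 i2] at ibp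
  have e2 : (∫ y in a..c, S y * (-(I * π * m) * cexp (-(I * π * m * y)))) = -(I * π * m) * dpiece a c S m := by
    rw [dpiece, ← intervalIntegral.integral_const_mul]
    refine intervalIntegral.integral_congr fun y _ => ?_
    ring
  rw [e2] at ibp
  rw [dpiece]
  linear_combination ibp

/-- The four real densities of the bulk form are interval integrable, and the bulk form splits into the four
pairings `Re∫conj S″·S″`, `Im∫conj S′·S″`, `Re∫conj S′·S′`, `Im∫conj S·S′`.
[cite: Zhang2022LandauSiegel, Prop 7.1 p.44 with (7.2), (8.11)–(8.23)] -/
theorem bulkFormOn_eq_pairings (b : Fin 3 → ℝ) (hac : a ≤ c) {S S' S'' : ℝ → ℂ} (hS : ContinuousOn S (Icc a c))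
    (hS' : ContinuousOn S' (Icc a c)) (hS''m : MemLp S'' 2 (volume.restrict (Ioc a c))) :
    bulkFormOn b a c S S' S''
      = (∫ y in a..c, conj (S'' y) * S'' y).re
        + π * (b 0 + b 1 + b 2) * (∫ y in a..c, conj (S' y) * S'' y).im
        + π ^ 2 * (b 0 * b 1 + b 1 * b 2 + b 2 * b 0) * (∫ y in a..c, conj (S' y) * S' y).re
        + π ^ 3 * (b 0 * b 1 * b 2) * (∫ y in a..c, conj (S y) * S' y).im := by
  have mS' : MemLp S' 2 (volume.restrict (Ioc a c)) := memLp_two_of_continuousOn_Icc' hS'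
  have iA : IntervalIntegrable (fun y => conj (S'' y) * S'' y) volume a c :=
    intervalIntegrable_conj_mul_self_of_memLp' hac hS''m
  have iB : IntervalIntegrable (fun y => conj (S' y) * S'' y) volume a c :=
    intervalIntegrable_conj_mul_of_continuousOn_of_memLp' hac hS' hS''m
  have iC : IntervalIntegrable (fun y => conj (S' y) * S' y) volume a c :=
    intervalIntegrable_conj_mul_of_continuousOn_of_memLp' hac hS' mS'
  have iD : IntervalIntegrable (fun y => conj (S y) * S' y) volume a c :=
    intervalIntegrable_conj_mul_of_continuousOn_of_memLp' hac hS mS'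
  -- re / im under the integral
  have eA : (∫ y in a..c, ‖S'' y‖ ^ 2) = (∫ y in a..c, conj (S'' y) * S'' y).re := by
    have h := Complex.reCLM.intervalIntegral_comp_comm iA
    simp only [Complex.reCLM_apply] at h
    rw [← h]
    refine intervalIntegral.integral_congr fun y _ => ?_
    simp only [Complex.conj_mul', ← Complex.ofReal_pow, Complex.ofReal_re]
  have eB : (∫ y in a..c, (S'' y * conj (S' y)).im) = (∫ y in a..c, conj (S' y) * S'' y).im := by
    have h := Complex.imCLM.intervalIntegral_comp_comm iB
    simp only [Complex.imCLM_apply] at h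
    rw [← h]
    refine intervalIntegral.integral_congr fun y _ => ?_
    simp only [mul_comm]
  have eC : (∫ y in a..c, ‖S' y‖ ^ 2) = (∫ y in a..c, conj (S' y) * S' y).re := by
    have h := Complex.reCLM.intervalIntegral_comp_comm iC
    simp only [Complex.reCLM_apply] at h
    rw [← h]
    refine intervalIntegral.integral_congr fun y _ => ?_
    simp only [Complex.conj_mul', ← Complex.ofReal_pow, Complex.ofReal_re]
  have eD : (∫ y in a..c, (S' y * conj (S y)).im) = (∫ y in a..c, conj (S y) * S' y).im := by
    have h := Complex.imCLM.intervalIntegral_comp_comm iD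
    simp only [Complex.imCLM_apply] at h
    rw [← h]
    refine intervalIntegral.integral_congr fun y _ => ?_
    simp only [mul_comm]
  -- integrability of the real densities
  have rA : IntervalIntegrable (fun y => ‖S'' y‖ ^ 2) volume a c := by
    rw [intervalIntegrable_iff_integrableOn_Ioc_of_le hac]
    exact (memLp_two_iff_integrable_sq_norm hS''m.1).1 hS''m
  have rB : IntervalIntegrable (fun y => π * (b 0 + b 1 + b 2) * (S'' y * conj (S' y)).im) volume a c := by
    have h1 : IntervalIntegrable (fun y => (conj (S' y) * S'' y).im) volume a c := by
      rw [intervalIntegrable_iff_integrableOn_Ioc_of_le hac] at iB ⊢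
      exact iB.im
    exact (h1.congr fun y _ => by simp only [mul_comm]).const_mul _
  have rC : IntervalIntegrable (fun y => π ^ 2 * (b 0 * b 1 + b 1 * b 2 + b 2 * b 0) * ‖S' y‖ ^ 2) volume a c := by
    have : ContinuousOn (fun y => ‖S' y‖ ^ 2) (Icc a c) := (hS'.norm).pow 2
    exact (this.intervalIntegrable_of_Icc hac).const_mul _
  have rD : IntervalIntegrable (fun y => π ^ 3 * (b 0 * b 1 * b 2) * (S' y * conj (S y)).im) volume a c := by
    have : ContinuousOn (fun y => (S' y * conj (S y)).im) (Icc a c) :=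
      Complex.continuous_im.comp_continuousOn (hS'.mul (Complex.continuous_conj.comp_continuousOn hS))
    exact (this.intervalIntegrable_of_Icc hac).const_mul _
  rw [bulkFormOn, intervalIntegral.integral_add ((rA.add rB).add rC) rD,
    intervalIntegral.integral_add (rA.add rB) rC, intervalIntegral.integral_add rA rB,
    intervalIntegral.integral_const_mul, intervalIntegral.integral_const_mul, intervalIntegral.integral_const_mul,
    eA, eB, eC, eD]

end Interval

/-! ### Part 3 — gluing two pieces on `[−1,0] ∪ [0,1]` and Parseval on the period cell `(−1, 1]` -/

section Glue

/-- Glue a left piece on `(−∞, 0]` to a right piece on `(0, ∞)`. [cite: Zhang2022LandauSiegel, Prop 7.1 p.44 with (7.2), (8.11)–(8.23)] -/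
def glue (fL fR : ℝ → ℂ) : ℝ → ℂ := (Set.Iic (0:ℝ)).piecewise fL fR

/-- Left values. [cite: Zhang2022LandauSiegel, Prop 7.1 p.44 with (7.2), (8.11)–(8.23)] -/
theorem glue_of_le {fL fR : ℝ → ℂ} {y : ℝ} (hy : y ≤ 0) : glue fL fR y = fL y :=
  Set.piecewise_eq_of_mem _ _ _ (Set.mem_Iic.2 hy)

/-- Right values. [cite: Zhang2022LandauSiegel, Prop 7.1 p.44 with (7.2), (8.11)–(8.23)] -/
theorem glue_of_pos {fL fR : ℝ → ℂ} {y : ℝ} (hy : 0 < y) : glue fL fR y = fR y :=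
  Set.piecewise_eq_of_notMem _ _ _ (by simpa using hy)

/-- A pointwise binary expression of two glued functions is the glue of the piecewise expressions.
[cite: Zhang2022LandauSiegel, Prop 7.1 p.44 with (7.2), (8.11)–(8.23)] -/
theorem glue_map₂ (F : ℂ → ℂ → ℂ) (aL aR cL cR : ℝ → ℂ) :
    (fun y => F (glue aL aR y) (glue cL cR y)) = glue (fun y => F (aL y) (cL y)) (fun y => F (aR y) (cR y)) := by
  funext y
  by_cases hy : y ≤ 0
  · simp only [glue_of_le hy]
  · simp only [glue_of_pos (not_le.1 hy)]

/-- A pointwise expression of one glued function with a `y`-dependent factor.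
[cite: Zhang2022LandauSiegel, Prop 7.1 p.44 with (7.2), (8.11)–(8.23)] -/
theorem glue_map₁ (F : ℝ → ℂ → ℂ) (aL aR : ℝ → ℂ) :
    (fun y => F y (glue aL aR y)) = glue (fun y => F y (aL y)) (fun y => F y (aR y)) := by
  funext y
  by_cases hy : y ≤ 0
  · simp only [glue_of_le hy]
  · simp only [glue_of_pos (not_le.1 hy)]

/-- **The glued integral splits**: `∫_{−1}^{1} glue φ_L φ_R = ∫_{−1}^{0} φ_L + ∫_{0}^{1} φ_R`, with integrability.
[cite: Zhang2022LandauSiegel, Prop 7.1 p.44 with (7.2), (8.11)–(8.23)] -/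
theorem integral_glue {φL φR : ℝ → ℂ} (hL : IntervalIntegrable φL volume (-1) 0)
    (hR : IntervalIntegrable φR volume 0 1) :
    IntervalIntegrable (glue φL φR) volume (-1) 1 ∧
      (∫ y in (-1:ℝ)..1, glue φL φR y) = (∫ y in (-1:ℝ)..0, φL y) + ∫ y in (0:ℝ)..1, φR y := by
  have hL' : IntervalIntegrable (glue φL φR) volume (-1) 0 := by
    refine hL.congr fun y hy => ?_
    rw [uIoc_of_le (by norm_num)] at hy
    exact (glue_of_le hy.2).symm
  have hR' : IntervalIntegrable (glue φL φR) volume 0 1 := by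
    refine hR.congr fun y hy => ?_
    rw [uIoc_of_le zero_le_one] at hy
    exact (glue_of_pos hy.1).symm
  refine ⟨hL'.trans hR', ?_⟩
  rw [← intervalIntegral.integral_add_adjacent_intervals hL' hR']
  congr 1
  · refine intervalIntegral.integral_congr fun y hy => ?_
    rw [uIcc_of_le (by norm_num)] at hy
    exact glue_of_le hy.2
  · refine intervalIntegral.integral_congr_ae ?_
    filter_upwards with y hy
    rw [uIoc_of_le zero_le_one] at hy
    exact glue_of_pos hy.1

/-- **The glued function is square-integrable on the cell** when the pieces are.
[cite: Zhang2022LandauSiegel, Prop 7.1 p.44 with (7.2), (8.11)–(8.23)] -/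
theorem memLp_glue {fL fR : ℝ → ℂ} (hL : MemLp fL 2 (volume.restrict (Ioc (-1:ℝ) 0)))
    (hR : MemLp fR 2 (volume.restrict (Ioc (0:ℝ) 1))) :
    MemLp (glue fL fR) 2 (volume.restrict (Ioc (-1:ℝ) 1)) := by
  have h1 : (volume.restrict (Ioc (-1:ℝ) 1)).restrict (Iic 0) = volume.restrict (Ioc (-1:ℝ) 0) := by
    rw [Measure.restrict_restrict measurableSet_Iic]
    congr 1
    ext x
    simp only [mem_inter_iff, mem_Iic, mem_Ioc]
    constructor
    · rintro ⟨h0, h1, _⟩; exact ⟨h1, h0⟩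
    · rintro ⟨h1, h0⟩; exact ⟨h0, h1, h0.trans zero_le_one⟩
  have h2 : (volume.restrict (Ioc (-1:ℝ) 1)).restrict (Iic 0)ᶜ = volume.restrict (Ioc (0:ℝ) 1) := by
    rw [Measure.restrict_restrict measurableSet_Iic.compl, Set.compl_Iic]
    congr 1
    ext x
    simp only [mem_inter_iff, mem_Ioi, mem_Ioc]
    constructor
    · rintro ⟨h0, _, h1⟩; exact ⟨h0, h1⟩
    · rintro ⟨h0, h1⟩; exact ⟨h0, by linarith, h1⟩
  have hL' : MemLp fL 2 ((volume.restrict (Ioc (-1:ℝ) 1)).restrict (Iic 0)) := by rw [h1]; exact hL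
  have hR' : MemLp fR 2 ((volume.restrict (Ioc (-1:ℝ) 1)).restrict (Iic 0)ᶜ) := by rw [h2]; exact hR
  exact MemLp.piecewise measurableSet_Iic hL' hR'

/-- The period cell `(−1, −1 + 2]`. [cite: Zhang2022LandauSiegel, Prop 7.1 p.44 with (7.2), (8.11)–(8.23)] -/
theorem cell_lt : (-1:ℝ) < -1 + 2 := lt_add_of_pos_right (-1) two_pos

/-- Mathlib's coefficient on the cell is half the cell transform:
`fourierCoeffOn (−1 < −1+2) F m = ½·∫_{−1}^{1} F e^{−iπm·}`. [cite: Zhang2022LandauSiegel, Prop 7.1 p.44 with (7.2), (8.11)–(8.23)] -/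
theorem fourierCoeffOn_cell_eq (F : ℝ → ℂ) (m : ℤ) : fourierCoeffOn cell_lt F m = (1 / 2 : ℂ) * dpiece (-1) 1 F m := by
  rw [fourierCoeffOn_eq_integral, dpiece]
  have hb : (-1 : ℝ) + 2 = 1 := by norm_num
  rw [hb]
  simp only [smul_eq_mul, Complex.real_smul]
  rw [← intervalIntegral.integral_const_mul, ← intervalIntegral.integral_const_mul]
  refine intervalIntegral.integral_congr fun y _ => ?_
  simp only [fourier_coe_apply]
  push_cast
  ring_nf

/-- **Polarised Parseval on the period cell `(−1, 1]`, `MemLp` shape** for two glued functions: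
`Σ_m conj D_F(m)·D_G(m) = 2·(∫_{−1}^{0} conj F_L·G_L + ∫_{0}^{1} conj F_R·G_R)` with
`D_F(m) = ∫_{−1}^{0} F_L k_m + ∫_0^1 F_R k_m`. [cite: Zhang2022LandauSiegel, Prop 7.1 p.44 with (7.2), (8.11)–(8.23)] -/
theorem hasSum_conj_glue_mul {fL fR gL gR : ℝ → ℂ}
    (hfL : MemLp fL 2 (volume.restrict (Ioc (-1:ℝ) 0))) (hfR : MemLp fR 2 (volume.restrict (Ioc (0:ℝ) 1)))
    (hgL : MemLp gL 2 (volume.restrict (Ioc (-1:ℝ) 0))) (hgR : MemLp gR 2 (volume.restrict (Ioc (0:ℝ) 1)))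
    (hfcL : ContinuousOn fL (Icc (-1:ℝ) 0) ∨ fL = gL) (hfcR : ContinuousOn fR (Icc (0:ℝ) 1) ∨ fR = gR) :
    HasSum (fun m : ℤ => conj (dpiece (-1) 0 fL m + dpiece 0 1 fR m) * (dpiece (-1) 0 gL m + dpiece 0 1 gR m))
      (2 * ((∫ y in (-1:ℝ)..0, conj (fL y) * gL y) + ∫ y in (0:ℝ)..1, conj (fR y) * gR y)) := by
  have hb : (-1 : ℝ) + 2 = 1 := by norm_num
  have hF := memLp_glue hfL hfR
  have hG := memLp_glue hgL hgR
  have hF1 : MemLp (glue fL fR) 2 (volume.restrict (Ioc (-1:ℝ) (-1 + 2))) := by rw [hb]; exact hF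
  have hG1 : MemLp (glue gL gR) 2 (volume.restrict (Ioc (-1:ℝ) (-1 + 2))) := by rw [hb]; exact hG
  have key := Literature.Analysis.Fourier.hasSum_conj_fourierCoeffOn_mul (c := -1) two_pos hF1 hG1
  simp only [fourierCoeffOn_cell_eq, map_mul, map_div₀, map_one] at key
  rw [hb] at key
  have h2 : conj (2 : ℂ) = 2 := by
    rw [show (2 : ℂ) = ((2 : ℝ) : ℂ) by norm_num, Complex.conj_ofReal]
  simp only [h2] at key
  -- the glued transforms and the glued pairing split
  have kcont : ∀ m : ℤ, Continuous fun y : ℝ => cexp (-(I * π * m * y)) := fun m => by fun_prop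
  have dF : ∀ m : ℤ, dpiece (-1) 1 (glue fL fR) m = dpiece (-1) 0 fL m + dpiece 0 1 fR m := by
    intro m
    have hL : IntervalIntegrable (fun y => fL y * cexp (-(I * π * m * y))) volume (-1) 0 :=
      (intervalIntegrable_of_memLp_Ioc (by norm_num) hfL).mul_continuousOn (kcont m).continuousOn
    have hR : IntervalIntegrable (fun y => fR y * cexp (-(I * π * m * y))) volume 0 1 :=
      (intervalIntegrable_of_memLp_Ioc zero_le_one hfR).mul_continuousOn (kcont m).continuousOn
    have := (integral_glue hL hR).2
    rw [dpiece, dpiece, dpiece, ← this, glue_map₁ (fun y z => z * cexp (-(I * π * m * y)))]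
  have dG : ∀ m : ℤ, dpiece (-1) 1 (glue gL gR) m = dpiece (-1) 0 gL m + dpiece 0 1 gR m := by
    intro m
    have hL : IntervalIntegrable (fun y => gL y * cexp (-(I * π * m * y))) volume (-1) 0 :=
      (intervalIntegrable_of_memLp_Ioc (by norm_num) hgL).mul_continuousOn (kcont m).continuousOn
    have hR : IntervalIntegrable (fun y => gR y * cexp (-(I * π * m * y))) volume 0 1 :=
      (intervalIntegrable_of_memLp_Ioc zero_le_one hgR).mul_continuousOn (kcont m).continuousOn
    have := (integral_glue hL hR).2
    rw [dpiece, dpiece, dpiece, ← this, glue_map₁ (fun y z => z * cexp (-(I * π * m * y)))]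
  have pL : IntervalIntegrable (fun y => conj (fL y) * gL y) volume (-1) 0 := by
    rcases hfcL with h | h
    · exact intervalIntegrable_conj_mul_of_continuousOn_of_memLp' (by norm_num) h hgL
    · subst h; exact intervalIntegrable_conj_mul_self_of_memLp' (by norm_num) hfL
  have pR : IntervalIntegrable (fun y => conj (fR y) * gR y) volume 0 1 := by
    rcases hfcR with h | h
    · exact intervalIntegrable_conj_mul_of_continuousOn_of_memLp' zero_le_one h hgR
    · subst h; exact intervalIntegrable_conj_mul_self_of_memLp' zero_le_one hfR
  have dP : (∫ y in (-1:ℝ)..1, conj (glue fL fR y) * glue gL gR y)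
      = (∫ y in (-1:ℝ)..0, conj (fL y) * gL y) + ∫ y in (0:ℝ)..1, conj (fR y) * gR y := by
    rw [glue_map₂ (fun w z => conj w * z), (integral_glue pL pR).2]
  have key4 := key.mul_left (4 : ℂ)
  have hfun : (fun m : ℤ => (4 : ℂ) * (1 / 2 * conj (dpiece (-1) 1 (glue fL fR) m) * (1 / 2 * dpiece (-1) 1 (glue gL gR) m)))
      = fun m : ℤ => conj (dpiece (-1) 0 fL m + dpiece 0 1 fR m) * (dpiece (-1) 0 gL m + dpiece 0 1 gR m) := by
    funext m; rw [dF, dG]; ring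
  have hval : (4 : ℂ) * ((2 : ℝ)⁻¹ • ∫ y in (-1:ℝ)..1, conj (glue fL fR y) * glue gL gR y)
      = 2 * ((∫ y in (-1:ℝ)..0, conj (fL y) * gL y) + ∫ y in (0:ℝ)..1, conj (fR y) * gR y) := by
    rw [Complex.real_smul, dP]
    push_cast
    ring
  rw [hfun, hval] at key4
  exact key4

end Glue

/-! ### Part 4 — the diagonalisation of the two-piece bulk form -/

section Main

variable {SL SL' SL'' SR SR' SR'' : ℝ → ℂ}

/-- The two-piece derivative rule: with clamps at `±1` replaced by the weaker periodicity/matching identities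
`S_L(−1)k(−1) = S_R(1)k(1)` (both `0` under the clamps) and `S_L(0) = S_R(0)`:
`D_{S′}(m) = iπm·D_S(m)`, `D_F(m) := ∫_{−1}^0 F_L k_m + ∫_0^1 F_R k_m`. [cite: Zhang2022LandauSiegel, Prop 7.1 p.44 with (7.2), (8.11)–(8.23)] -/
theorem dglue_deriv {SL SL' SR SR' : ℝ → ℂ} (hSL : ContinuousOn SL (Icc (-1:ℝ) 0))
    (hSR : ContinuousOn SR (Icc (0:ℝ) 1))
    (hL : ∀ y ∈ Ioo (-1:ℝ) 0, HasDerivWithinAt SL (SL' y) (Ioi y) y)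
    (hR : ∀ y ∈ Ioo (0:ℝ) 1, HasDerivWithinAt SR (SR' y) (Ioi y) y)
    (hSL'i : IntervalIntegrable SL' volume (-1) 0) (hSR'i : IntervalIntegrable SR' volume 0 1)
    (hcl : SL (-1) = 0) (hcr : SR 1 = 0) (hmatch : SL 0 = SR 0) (m : ℤ) :
    dpiece (-1) 0 SL' m + dpiece 0 1 SR' m = I * π * m * (dpiece (-1) 0 SL m + dpiece 0 1 SR m) := by
  have h1 := dpiece_deriv (by norm_num : (-1:ℝ) ≤ 0) hSL hL hSL'i m
  have h2 := dpiece_deriv (zero_le_one : (0:ℝ) ≤ 1) hSR hR hSR'i m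
  rw [h1, h2, hcl, hcr, hmatch]
  push_cast
  ring

/-- The four lattice summands of the two-piece bulk form. [cite: Zhang2022LandauSiegel, Prop 7.1 p.44 with (7.2), (8.11)–(8.23)] -/
private theorem two_piece_pairing_terms (hSL : ContinuousOn SL (Icc (-1:ℝ) 0)) (hSL' : ContinuousOn SL' (Icc (-1:ℝ) 0))
    (hSR : ContinuousOn SR (Icc (0:ℝ) 1)) (hSR' : ContinuousOn SR' (Icc (0:ℝ) 1))
    (hL1 : ∀ y ∈ Ioo (-1:ℝ) 0, HasDerivWithinAt SL (SL' y) (Ioi y) y)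
    (hL2 : ∀ y ∈ Ioo (-1:ℝ) 0, HasDerivWithinAt SL' (SL'' y) (Ioi y) y)
    (hR1 : ∀ y ∈ Ioo (0:ℝ) 1, HasDerivWithinAt SR (SR' y) (Ioi y) y)
    (hR2 : ∀ y ∈ Ioo (0:ℝ) 1, HasDerivWithinAt SR' (SR'' y) (Ioi y) y)
    (hSL''m : MemLp SL'' 2 (volume.restrict (Ioc (-1:ℝ) 0))) (hSR''m : MemLp SR'' 2 (volume.restrict (Ioc (0:ℝ) 1)))
    (h0 : SL (-1) = 0) (h0' : SL' (-1) = 0) (h1 : SR 1 = 0) (h1' : SR' 1 = 0)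
    (hm0 : SL 0 = SR 0) (hm1 : SL' 0 = SR' 0) (m : ℤ) :
    let D : ℂ := dpiece (-1) 0 SL m + dpiece 0 1 SR m
    let D' : ℂ := dpiece (-1) 0 SL' m + dpiece 0 1 SR' m
    let D'' : ℂ := dpiece (-1) 0 SL'' m + dpiece 0 1 SR'' m
    conj D'' * D'' = (((π ^ 4 * (m : ℝ) ^ 4 * ‖D‖ ^ 2 : ℝ)) : ℂ)
    ∧ conj D' * D'' = I * ((((π ^ 3 * (m : ℝ) ^ 3 * ‖D‖ ^ 2) : ℝ)) : ℂ)
    ∧ conj D' * D' = (((π ^ 2 * (m : ℝ) ^ 2 * ‖D‖ ^ 2 : ℝ)) : ℂ)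
    ∧ conj D * D' = I * ((((π * (m : ℝ) * ‖D‖ ^ 2) : ℝ)) : ℂ) := by
  intro D D' D''
  have hd1 : D' = I * π * (m : ℂ) * D :=
    dglue_deriv hSL hSR hL1 hR1 (hSL'.intervalIntegrable_of_Icc (by norm_num))
      (hSR'.intervalIntegrable_of_Icc zero_le_one) h0 h1 hm0 m
  have hd2 : D'' = I * π * (m : ℂ) * D' :=
    dglue_deriv hSL' hSR' hL2 hR2 (intervalIntegrable_of_memLp_Ioc (by norm_num) hSL''m)
      (intervalIntegrable_of_memLp_Ioc zero_le_one hSR''m) h0' h1' hm1 m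
  have hsq : conj D * D = (((‖D‖ ^ 2 : ℝ)) : ℂ) := by
    rw [Complex.conj_mul', Complex.ofReal_pow]
  have hsq' : conj D * D = ((‖D‖ : ℂ)) ^ 2 := by
    rw [hsq, Complex.ofReal_pow]
  have hI : I * I = -1 := Complex.I_mul_I
  refine ⟨?_, ?_, ?_, ?_⟩
  · rw [hd2, hd1]
    simp only [map_mul, Complex.conj_I, Complex.conj_ofReal, map_intCast]
    push_cast
    linear_combination ((π : ℂ) ^ 4 * (m : ℂ) ^ 4 * I ^ 4) * hsq'
      + ((π : ℂ) ^ 4 * (m : ℂ) ^ 4 * ((‖D‖ : ℂ)) ^ 2 * (I * I - 1)) * hI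
  · rw [hd2, hd1]
    simp only [map_mul, Complex.conj_I, Complex.conj_ofReal, map_intCast]
    push_cast
    linear_combination (-(I ^ 3) * (π : ℂ) ^ 3 * (m : ℂ) ^ 3) * hsq'
      + (-(I * (π : ℂ) ^ 3 * (m : ℂ) ^ 3 * ((‖D‖ : ℂ)) ^ 2)) * hI
  · rw [hd1]
    simp only [map_mul, Complex.conj_I, Complex.conj_ofReal, map_intCast]
    push_cast
    linear_combination (-(I ^ 2) * (π : ℂ) ^ 2 * (m : ℂ) ^ 2) * hsq'
      + (-((π : ℂ) ^ 2 * (m : ℂ) ^ 2 * ((‖D‖ : ℂ)) ^ 2)) * hI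
  · rw [hd1]
    push_cast
    linear_combination (I * (π : ℂ) * (m : ℂ)) * hsq'

/-- **[K3] the diagonalisation of the two-piece bulk form.** For pieces `S_L` on `[−1,0]` and `S_R` on `[0,1]`,
each continuous with a continuous derivative and right-derivatives `S → S′ → S″` on the OPEN piece, `S″ ∈ L²` on
each piece, clamped at `±1` (`S_L(−1) = S_L′(−1) = 0 = S_R(1) = S_R′(1)`) and `C¹`-matched at `0`, and every real
triple `b`: `HasSum (m ↦ (π⁴/2)·(m⁴ + e₁m³ + e₂m² + e₃m)·|D(m)|²) (T_b^{[−1,0]}(S_L) + T_b^{[0,1]}(S_R))` with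
`D(m) = ∫_{−1}^0 S_L e^{−iπm·} + ∫_0^1 S_R e^{−iπm·}`. [cite: Zhang2022LandauSiegel, Prop 7.1 p.44 with (7.2), (8.11)–(8.23)] -/
theorem hasSum_bulkFormOn_two_piece (b : Fin 3 → ℝ)
    (hSL : ContinuousOn SL (Icc (-1:ℝ) 0)) (hSL' : ContinuousOn SL' (Icc (-1:ℝ) 0))
    (hSR : ContinuousOn SR (Icc (0:ℝ) 1)) (hSR' : ContinuousOn SR' (Icc (0:ℝ) 1))
    (hL1 : ∀ y ∈ Ioo (-1:ℝ) 0, HasDerivWithinAt SL (SL' y) (Ioi y) y)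
    (hL2 : ∀ y ∈ Ioo (-1:ℝ) 0, HasDerivWithinAt SL' (SL'' y) (Ioi y) y)
    (hR1 : ∀ y ∈ Ioo (0:ℝ) 1, HasDerivWithinAt SR (SR' y) (Ioi y) y)
    (hR2 : ∀ y ∈ Ioo (0:ℝ) 1, HasDerivWithinAt SR' (SR'' y) (Ioi y) y)
    (hSL''m : MemLp SL'' 2 (volume.restrict (Ioc (-1:ℝ) 0))) (hSR''m : MemLp SR'' 2 (volume.restrict (Ioc (0:ℝ) 1)))
    (h0 : SL (-1) = 0) (h0' : SL' (-1) = 0) (h1 : SR 1 = 0) (h1' : SR' 1 = 0)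
    (hm0 : SL 0 = SR 0) (hm1 : SL' 0 = SR' 0) :
    HasSum (fun m : ℤ => π ^ 4 / 2 *
        (((m : ℝ) ^ 4 + (b 0 + b 1 + b 2) * (m : ℝ) ^ 3 + (b 0 * b 1 + b 1 * b 2 + b 2 * b 0) * (m : ℝ) ^ 2
          + (b 0 * b 1 * b 2) * (m : ℝ)) * ‖dpiece (-1) 0 SL m + dpiece 0 1 SR m‖ ^ 2))
      (bulkFormOn b (-1) 0 SL SL' SL'' + bulkFormOn b 0 1 SR SR' SR'') := by
  have mSL : MemLp SL 2 (volume.restrict (Ioc (-1:ℝ) 0)) := memLp_two_of_continuousOn_Icc' hSL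
  have mSL' : MemLp SL' 2 (volume.restrict (Ioc (-1:ℝ) 0)) := memLp_two_of_continuousOn_Icc' hSL'
  have mSR : MemLp SR 2 (volume.restrict (Ioc (0:ℝ) 1)) := memLp_two_of_continuousOn_Icc' hSR
  have mSR' : MemLp SR' 2 (volume.restrict (Ioc (0:ℝ) 1)) := memLp_two_of_continuousOn_Icc' hSR'
  -- the four Parseval sums
  have hA := hasSum_conj_glue_mul hSL''m hSR''m hSL''m hSR''m (Or.inr rfl) (Or.inr rfl)
  have hB := hasSum_conj_glue_mul mSL' mSR' hSL''m hSR''m (Or.inl hSL') (Or.inl hSR')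
  have hC := hasSum_conj_glue_mul mSL' mSR' mSL' mSR' (Or.inl hSL') (Or.inl hSR')
  have hD := hasSum_conj_glue_mul mSL mSR mSL' mSR' (Or.inl hSL) (Or.inl hSR)
  -- their lattice summands
  have tt := fun m => two_piece_pairing_terms hSL hSL' hSR hSR' hL1 hL2 hR1 hR2 hSL''m hSR''m h0 h0' h1 h1' hm0 hm1 m
  have tA : (fun m : ℤ => conj (dpiece (-1) 0 SL'' m + dpiece 0 1 SR'' m) * (dpiece (-1) 0 SL'' m + dpiece 0 1 SR'' m))
      = fun m : ℤ => (((π ^ 4 * (m : ℝ) ^ 4 * ‖dpiece (-1) 0 SL m + dpiece 0 1 SR m‖ ^ 2 : ℝ)) : ℂ) :=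
    funext fun m => (tt m).1
  have tB : (fun m : ℤ => conj (dpiece (-1) 0 SL' m + dpiece 0 1 SR' m) * (dpiece (-1) 0 SL'' m + dpiece 0 1 SR'' m))
      = fun m : ℤ => I * ((((π ^ 3 * (m : ℝ) ^ 3 * ‖dpiece (-1) 0 SL m + dpiece 0 1 SR m‖ ^ 2) : ℝ)) : ℂ) :=
    funext fun m => (tt m).2.1
  have tC : (fun m : ℤ => conj (dpiece (-1) 0 SL' m + dpiece 0 1 SR' m) * (dpiece (-1) 0 SL' m + dpiece 0 1 SR' m))
      = fun m : ℤ => (((π ^ 2 * (m : ℝ) ^ 2 * ‖dpiece (-1) 0 SL m + dpiece 0 1 SR m‖ ^ 2 : ℝ)) : ℂ) :=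
    funext fun m => (tt m).2.2.1
  have tD : (fun m : ℤ => conj (dpiece (-1) 0 SL m + dpiece 0 1 SR m) * (dpiece (-1) 0 SL' m + dpiece 0 1 SR' m))
      = fun m : ℤ => I * ((((π * (m : ℝ) * ‖dpiece (-1) 0 SL m + dpiece 0 1 SR m‖ ^ 2) : ℝ)) : ℂ) :=
    funext fun m => (tt m).2.2.2
  rw [tA] at hA; rw [tB] at hB; rw [tC] at hC; rw [tD] at hD
  -- real / imaginary parts
  have rA : HasSum (fun m : ℤ => π ^ 4 * (m : ℝ) ^ 4 * ‖dpiece (-1) 0 SL m + dpiece 0 1 SR m‖ ^ 2)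
      (2 * ((∫ y in (-1:ℝ)..0, conj (SL'' y) * SL'' y) + ∫ y in (0:ℝ)..1, conj (SR'' y) * SR'' y)).re := by
    have := Complex.hasSum_re hA
    simpa only [Complex.ofReal_re] using this
  have iB : HasSum (fun m : ℤ => π ^ 3 * (m : ℝ) ^ 3 * ‖dpiece (-1) 0 SL m + dpiece 0 1 SR m‖ ^ 2)
      (2 * ((∫ y in (-1:ℝ)..0, conj (SL' y) * SL'' y) + ∫ y in (0:ℝ)..1, conj (SR' y) * SR'' y)).im := by
    have := Complex.hasSum_im hB
    simpa only [Complex.I_mul_im, Complex.ofReal_re] using this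
  have rC : HasSum (fun m : ℤ => π ^ 2 * (m : ℝ) ^ 2 * ‖dpiece (-1) 0 SL m + dpiece 0 1 SR m‖ ^ 2)
      (2 * ((∫ y in (-1:ℝ)..0, conj (SL' y) * SL' y) + ∫ y in (0:ℝ)..1, conj (SR' y) * SR' y)).re := by
    have := Complex.hasSum_re hC
    simpa only [Complex.ofReal_re] using this
  have iD : HasSum (fun m : ℤ => π * (m : ℝ) * ‖dpiece (-1) 0 SL m + dpiece 0 1 SR m‖ ^ 2)
      (2 * ((∫ y in (-1:ℝ)..0, conj (SL y) * SL' y) + ∫ y in (0:ℝ)..1, conj (SR y) * SR' y)).im := by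
    have := Complex.hasSum_im hD
    simpa only [Complex.I_mul_im, Complex.ofReal_re] using this
  set e1 : ℝ := b 0 + b 1 + b 2 with he1
  set e2 : ℝ := b 0 * b 1 + b 1 * b 2 + b 2 * b 0 with he2
  set e3 : ℝ := b 0 * b 1 * b 2 with he3
  have goal := ((rA.mul_left (1 / 2 : ℝ)).add ((iB.mul_left (π * e1 / 2)).add
    ((rC.mul_left (π ^ 2 * e2 / 2)).add (iD.mul_left (π ^ 3 * e3 / 2)))))
  have hfun : (fun m : ℤ => 1 / 2 * (π ^ 4 * (m : ℝ) ^ 4 * ‖dpiece (-1) 0 SL m + dpiece 0 1 SR m‖ ^ 2)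
      + (π * e1 / 2 * (π ^ 3 * (m : ℝ) ^ 3 * ‖dpiece (-1) 0 SL m + dpiece 0 1 SR m‖ ^ 2)
        + (π ^ 2 * e2 / 2 * (π ^ 2 * (m : ℝ) ^ 2 * ‖dpiece (-1) 0 SL m + dpiece 0 1 SR m‖ ^ 2)
          + π ^ 3 * e3 / 2 * (π * (m : ℝ) * ‖dpiece (-1) 0 SL m + dpiece 0 1 SR m‖ ^ 2))))
      = fun m : ℤ => π ^ 4 / 2 *
        (((m : ℝ) ^ 4 + e1 * (m : ℝ) ^ 3 + e2 * (m : ℝ) ^ 2 + e3 * (m : ℝ))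
          * ‖dpiece (-1) 0 SL m + dpiece 0 1 SR m‖ ^ 2) := by
    funext m; ring
  have hval : bulkFormOn b (-1) 0 SL SL' SL'' + bulkFormOn b 0 1 SR SR' SR''
      = 1 / 2 * (2 * ((∫ y in (-1:ℝ)..0, conj (SL'' y) * SL'' y) + ∫ y in (0:ℝ)..1, conj (SR'' y) * SR'' y)).re
        + (π * e1 / 2 * (2 * ((∫ y in (-1:ℝ)..0, conj (SL' y) * SL'' y) + ∫ y in (0:ℝ)..1, conj (SR' y) * SR'' y)).im
          + (π ^ 2 * e2 / 2 * (2 * ((∫ y in (-1:ℝ)..0, conj (SL' y) * SL' y) + ∫ y in (0:ℝ)..1, conj (SR' y) * SR' y)).re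
            + π ^ 3 * e3 / 2 * (2 * ((∫ y in (-1:ℝ)..0, conj (SL y) * SL' y) + ∫ y in (0:ℝ)..1, conj (SR y) * SR' y)).im)) := by
    rw [bulkFormOn_eq_pairings b (by norm_num) hSL hSL' hSL''m, bulkFormOn_eq_pairings b zero_le_one hSR hSR' hSR''m]
    simp only [← he1, ← he2, ← he3, Complex.add_re, Complex.add_im, Complex.mul_re, Complex.mul_im,
      Complex.re_ofNat, Complex.im_ofNat, zero_mul, sub_zero, add_zero]
    ring
  rw [hfun, ← hval] at goal
  exact goal

/-- **The K3 export** (the shape the composition K6 consumes): for every two-piece datum as in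
`hasSum_bulkFormOn_two_piece` and `σ_b ≥ 0` on `ℤ` (`∀ m, 0 ≤ bulkSymbol b m`), the doubled bulk form is `≥ 0`.
A `Prop` DEFINED here and PROVED below (`doubledBulkNonnegTwoPiece`). [cite: Zhang2022LandauSiegel, Prop 7.1 p.44 with (7.2), (8.11)–(8.23)] -/
def DoubledBulkNonnegTwoPiece (b : Fin 3 → ℝ) : Prop :=
  ∀ SL SL' SL'' SR SR' SR'' : ℝ → ℂ,
    ContinuousOn SL (Icc (-1) 0) → ContinuousOn SL' (Icc (-1) 0) →
    (∀ y ∈ Ioo (-1:ℝ) 0, HasDerivWithinAt SL (SL' y) (Ioi y) y) →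
    (∀ y ∈ Ioo (-1:ℝ) 0, HasDerivWithinAt SL' (SL'' y) (Ioi y) y) →
    MemLp SL'' 2 (volume.restrict (Ioc (-1:ℝ) 0)) →
    ContinuousOn SR (Icc 0 1) → ContinuousOn SR' (Icc 0 1) →
    (∀ y ∈ Ioo (0:ℝ) 1, HasDerivWithinAt SR (SR' y) (Ioi y) y) →
    (∀ y ∈ Ioo (0:ℝ) 1, HasDerivWithinAt SR' (SR'' y) (Ioi y) y) →
    MemLp SR'' 2 (volume.restrict (Ioc (0:ℝ) 1)) →
    SL (-1) = 0 → SL' (-1) = 0 → SR 1 = 0 → SR' 1 = 0 → SL 0 = SR 0 → SL' 0 = SR' 0 →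
    (∀ m : ℤ, 0 ≤ bulkSymbol b m) →
    0 ≤ bulkFormOn b (-1) 0 SL SL' SL'' + bulkFormOn b 0 1 SR SR' SR''

/-- `p_b(m) = m⁴ + e₁m³ + e₂m² + e₃m`. [cite: Zhang2022LandauSiegel, Prop 7.1 p.44 with (7.2), (8.11)–(8.23)] -/
theorem bulkSymbol_eq_poly (b : Fin 3 → ℝ) (x : ℝ) :
    bulkSymbol b x = x ^ 4 + (b 0 + b 1 + b 2) * x ^ 3 + (b 0 * b 1 + b 1 * b 2 + b 2 * b 0) * x ^ 2
      + (b 0 * b 1 * b 2) * x := by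
  rw [bulkSymbol]; ring

/-- **[K3] `Det.DoubledBulkNonnegTwoPiece b` holds for every real triple `b`.**
[cite: Zhang2022LandauSiegel, Prop 7.1 p.44 with (7.2), (8.11)–(8.23)] -/
theorem doubledBulkNonnegTwoPiece (b : Fin 3 → ℝ) : DoubledBulkNonnegTwoPiece b := by
  intro SL SL' SL'' SR SR' SR'' hSL hSL' hL1 hL2 hSL''m hSR hSR' hR1 hR2 hSR''m h0 h0' h1 h1' hm0 hm1 hlat
  refine (hasSum_bulkFormOn_two_piece b hSL hSL' hSR hSR' hL1 hL2 hR1 hR2 hSL''m hSR''m h0 h0' h1 h1' hm0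
    hm1).nonneg fun m => ?_
  have hσ := hlat m
  rw [bulkSymbol_eq_poly] at hσ
  positivity

/-- `DoubledBulkNonnegTwoPiece` holds for all parameters — `_holds` alias of `doubledBulkNonnegTwoPiece` above under the fact's exact name
(appended 2026-08-28, D-0026 bookkeeping: the proof term is the existing theorem of this file; no statement,
definition or attribute is edited; no new named fact; the ledger's debt table listed the fact
unproved). [cite: Zhang2022LandauSiegel, Prop 7.1 p.44 with (7.2), (8.11)–(8.23)] -/
theorem _root_.Literature.NumberTheory.LFunctions.Zhang2022.Det.DoubledBulkNonnegTwoPiece_holds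
    (b : Fin 3 → ℝ) :
    DoubledBulkNonnegTwoPiece b :=
  _root_.Literature.NumberTheory.LFunctions.Zhang2022.Det.doubledBulkNonnegTwoPiece b

/-- **For a SIGN-ADMISSIBLE triple the doubled two-piece bulk form is `≥ 0`** (K3 ∘ K4:
`SignAdmissible.bulkSymbol_intCast_nonneg`). [cite: Zhang2022LandauSiegel, Prop 7.1 p.44 with (7.2), (8.11)–(8.23)] -/
theorem bulkFormOn_two_piece_nonneg_of_signAdmissible (h : SignAdmissible b)
    (hSL : ContinuousOn SL (Icc (-1:ℝ) 0)) (hSL' : ContinuousOn SL' (Icc (-1:ℝ) 0))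
    (hL1 : ∀ y ∈ Ioo (-1:ℝ) 0, HasDerivWithinAt SL (SL' y) (Ioi y) y)
    (hL2 : ∀ y ∈ Ioo (-1:ℝ) 0, HasDerivWithinAt SL' (SL'' y) (Ioi y) y)
    (hSL''m : MemLp SL'' 2 (volume.restrict (Ioc (-1:ℝ) 0)))
    (hSR : ContinuousOn SR (Icc (0:ℝ) 1)) (hSR' : ContinuousOn SR' (Icc (0:ℝ) 1))
    (hR1 : ∀ y ∈ Ioo (0:ℝ) 1, HasDerivWithinAt SR (SR' y) (Ioi y) y)
    (hR2 : ∀ y ∈ Ioo (0:ℝ) 1, HasDerivWithinAt SR' (SR'' y) (Ioi y) y)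
    (hSR''m : MemLp SR'' 2 (volume.restrict (Ioc (0:ℝ) 1)))
    (h0 : SL (-1) = 0) (h0' : SL' (-1) = 0) (h1 : SR 1 = 0) (h1' : SR' 1 = 0)
    (hm0 : SL 0 = SR 0) (hm1 : SL' 0 = SR' 0) :
    0 ≤ bulkFormOn b (-1) 0 SL SL' SL'' + bulkFormOn b 0 1 SR SR' SR'' :=
  doubledBulkNonnegTwoPiece b SL SL' SL'' SR SR' SR'' hSL hSL' hL1 hL2 hSL''m hSR hSR' hR1 hR2 hSR''m h0 h0' h1
    h1' hm0 hm1 h.bulkSymbol_intCast_nonneg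

end Main

/-! ### Part 5 — the one-piece statement shape of the sketch (verbatim), as a corollary -/

/-- **(K3) Parseval on the doubled interval** (statement shape, ls-barrier-num g2's ShadowKernelSketch.lean
1268210b689bb6c5 l.194, VERBATIM): the bulk form of a `C¹`, piecewise-`H²`, DOUBLY CLAMPED function on `[−1, 1]`
is `≥ 0` whenever the lattice symbol is. PROVED below (`doubledBulkNonneg`) for every `b`, as the case
`S_L = S_R = S` of the two-piece theorem. [cite: Zhang2022LandauSiegel, Prop 7.1 p.44 with (7.2), (8.11)–(8.23)] -/
def DoubledBulkNonneg (b : Fin 3 → ℝ) : Prop :=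
  ∀ S S' S'' : ℝ → ℂ, ContinuousOn S (Icc (-1) 1) → ContinuousOn S' (Icc (-1) 1) →
    (∀ y ∈ Ioo (-1:ℝ) 1, HasDerivWithinAt S (S' y) (Ioi y) y) →
    (∀ y ∈ Ioo (-1:ℝ) 1, HasDerivWithinAt S' (S'' y) (Ioi y) y) →
    MeasureTheory.MemLp S'' 2 (MeasureTheory.volume.restrict (Ioc (-1:ℝ) 1)) →
    S (-1) = 0 → S' (-1) = 0 → S 1 = 0 → S' 1 = 0 →
    (∀ m : ℤ, 0 ≤ (m : ℝ) * ((m : ℝ) + b 0) * (((m : ℝ) + b 1) * ((m : ℝ) + b 2))) →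
    0 ≤ bulkFormOn b (-1) 1 S S' S''

/-- The bulk form on `[−1,1]` is the sum of the two halves (integrability of the density from the hypotheses).
[cite: Zhang2022LandauSiegel, Prop 7.1 p.44 with (7.2), (8.11)–(8.23)] -/
theorem bulkFormOn_split {S S' S'' : ℝ → ℂ} (b : Fin 3 → ℝ) (hS : ContinuousOn S (Icc (-1:ℝ) 1))
    (hS' : ContinuousOn S' (Icc (-1:ℝ) 1)) (hS''m : MemLp S'' 2 (volume.restrict (Ioc (-1:ℝ) 1))) :
    bulkFormOn b (-1) 1 S S' S'' = bulkFormOn b (-1) 0 S S' S'' + bulkFormOn b 0 1 S S' S'' := by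
  -- integrability of the density on [−1,1]
  have hle : (-1:ℝ) ≤ 1 := by norm_num
  have iB : IntervalIntegrable (fun y => conj (S' y) * S'' y) volume (-1) 1 :=
    intervalIntegrable_conj_mul_of_continuousOn_of_memLp' hle hS' hS''m
  have rA : IntervalIntegrable (fun y => ‖S'' y‖ ^ 2) volume (-1) 1 := by
    rw [intervalIntegrable_iff_integrableOn_Ioc_of_le hle]
    exact (memLp_two_iff_integrable_sq_norm hS''m.1).1 hS''m
  have rB : IntervalIntegrable (fun y => π * (b 0 + b 1 + b 2) * (S'' y * conj (S' y)).im) volume (-1) 1 := by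
    have h1 : IntervalIntegrable (fun y => (conj (S' y) * S'' y).im) volume (-1) 1 := by
      rw [intervalIntegrable_iff_integrableOn_Ioc_of_le hle] at iB ⊢
      exact iB.im
    exact (h1.congr fun y _ => by simp only [mul_comm]).const_mul _
  have rC : IntervalIntegrable (fun y => π ^ 2 * (b 0 * b 1 + b 1 * b 2 + b 2 * b 0) * ‖S' y‖ ^ 2) volume (-1) 1 := by
    have : ContinuousOn (fun y => ‖S' y‖ ^ 2) (Icc (-1:ℝ) 1) := (hS'.norm).pow 2
    exact (this.intervalIntegrable_of_Icc hle).const_mul _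
  have rD : IntervalIntegrable (fun y => π ^ 3 * (b 0 * b 1 * b 2) * (S' y * conj (S y)).im) volume (-1) 1 := by
    have : ContinuousOn (fun y => (S' y * conj (S y)).im) (Icc (-1:ℝ) 1) :=
      Complex.continuous_im.comp_continuousOn (hS'.mul (Complex.continuous_conj.comp_continuousOn hS))
    exact (this.intervalIntegrable_of_Icc hle).const_mul _
  have hint := ((rA.add rB).add rC).add rD
  have hsubL : uIcc (-1:ℝ) 0 ⊆ uIcc (-1:ℝ) 1 := by
    rw [uIcc_of_le hle, uIcc_of_le (by norm_num : (-1:ℝ) ≤ 0)]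
    exact Icc_subset_Icc_right (by norm_num)
  have hsubR : uIcc (0:ℝ) 1 ⊆ uIcc (-1:ℝ) 1 := by
    rw [uIcc_of_le hle, uIcc_of_le (zero_le_one : (0:ℝ) ≤ 1)]
    exact Icc_subset_Icc_left (by norm_num)
  rw [bulkFormOn, bulkFormOn, bulkFormOn,
    ← intervalIntegral.integral_add_adjacent_intervals (hint.mono_set hsubL) (hint.mono_set hsubR)]

/-- **[K3] `Det.DoubledBulkNonneg b` (the sketch's one-piece shape) holds for every real triple `b`.**
[cite: Zhang2022LandauSiegel, Prop 7.1 p.44 with (7.2), (8.11)–(8.23)] -/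
theorem doubledBulkNonneg (b : Fin 3 → ℝ) : DoubledBulkNonneg b := by
  intro S S' S'' hS hS' hSS' hS'S'' hS''m h0 h0' h1 h1' hlat
  rw [bulkFormOn_split b hS hS' hS''m]
  have hlat' : ∀ m : ℤ, 0 ≤ bulkSymbol b m := fun m => by
    rw [bulkSymbol]; nlinarith [hlat m]
  exact doubledBulkNonnegTwoPiece b S S' S'' S S' S''
    (hS.mono (Icc_subset_Icc_right (by norm_num))) (hS'.mono (Icc_subset_Icc_right (by norm_num)))
    (fun y hy => hSS' y ⟨hy.1, hy.2.trans_le (by norm_num)⟩) (fun y hy => hS'S'' y ⟨hy.1, hy.2.trans_le (by norm_num)⟩)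
    (hS''m.mono_measure (Measure.restrict_mono (Ioc_subset_Ioc_right (by norm_num)) le_rfl))
    (hS.mono (Icc_subset_Icc_left (by norm_num))) (hS'.mono (Icc_subset_Icc_left (by norm_num)))
    (fun y hy => hSS' y ⟨(by norm_num : (-1:ℝ) < 0).trans hy.1, hy.2⟩)
    (fun y hy => hS'S'' y ⟨(by norm_num : (-1:ℝ) < 0).trans hy.1, hy.2⟩)
    (hS''m.mono_measure (Measure.restrict_mono (Ioc_subset_Ioc_left (by norm_num)) le_rfl))
    h0 h0' h1 h1' rfl rfl hlat'

/-- `DoubledBulkNonneg` holds for all parameters — `_holds` alias of `doubledBulkNonneg` above under the fact's exact name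
(appended 2026-08-28, D-0026 bookkeeping: the proof term is the existing theorem of this file; no statement,
definition or attribute is edited; no new named fact; the ledger's debt table listed the fact
unproved). [cite: Zhang2022LandauSiegel, Prop 7.1 p.44 with (7.2), (8.11)–(8.23)] -/
theorem _root_.Literature.NumberTheory.LFunctions.Zhang2022.Det.DoubledBulkNonneg_holds
    (b : Fin 3 → ℝ) :
    DoubledBulkNonneg b :=
  _root_.Literature.NumberTheory.LFunctions.Zhang2022.Det.doubledBulkNonneg b

/-! ### Part 6 — the right piece from a one-sided kinked profile, and the glued corollary K6 consumes -/

section RightPiece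

variable {g g' : ℝ → ℂ}

/-- **The right piece of the doubling from a one-sided kinked profile**: `S_R = tailPrim g = ∫_y^1 g`, `S_R′ = −g`,
`S_R″ = −g′` satisfy the right-piece hypotheses of `DoubledBulkNonnegTwoPiece` (continuity, right-derivatives on
`(0,1)`, `L²`, clamps at `1`). [cite: Zhang2022LandauSiegel, Prop 7.1 p.44 with (7.2), (8.11)–(8.23)] -/
theorem rightPiece_of_kinked (hg : KinkedProfile g g') (hg1 : g 1 = 0) :
    ContinuousOn (tailPrim g) (Icc (0:ℝ) 1) ∧ ContinuousOn (fun y => -g y) (Icc (0:ℝ) 1)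
    ∧ (∀ y ∈ Ioo (0:ℝ) 1, HasDerivWithinAt (tailPrim g) (-g y) (Ioi y) y)
    ∧ (∀ y ∈ Ioo (0:ℝ) 1, HasDerivWithinAt (fun y => -g y) (-g' y) (Ioi y) y)
    ∧ MemLp (fun y => -g' y) 2 (volume.restrict (Ioc (0:ℝ) 1))
    ∧ tailPrim g 1 = 0 ∧ -g 1 = 0 := by
  have hgc : ContinuousOn (fun y => -g y) (Icc (0:ℝ) 1) := hg.cont.neg
  have hgi : IntervalIntegrable g volume 0 1 := (hg.cont.mono (by rw [uIcc_of_le zero_le_one])).intervalIntegrable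
  -- the integral representation of the tail primitive
  have hrep : ∀ y ∈ Icc (0:ℝ) 1, tailPrim g y = tailPrim g 0 + ∫ t in (0:ℝ)..y, (fun t => -g t) t := by
    intro y hy
    rw [tailPrim_eq_sub hgi hy, tailPrim_zero, intervalIntegral.integral_neg]
    ring
  -- continuity of the tail primitive from the representation
  have hprim : ContinuousOn (fun y => tailPrim g 0 + ∫ t in (0:ℝ)..y, (fun t => -g t) t) (Icc (0:ℝ) 1) := by
    have hint : IntervalIntegrable (fun t => -g t) volume 0 1 :=
      (hgc.mono (by rw [uIcc_of_le zero_le_one])).intervalIntegrable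
    have := intervalIntegral.continuousOn_primitive_interval' hint (by simp : (0:ℝ) ∈ uIcc (0:ℝ) 1)
    rw [uIcc_of_le zero_le_one] at this
    exact continuousOn_const.add this
  have hcont : ContinuousOn (tailPrim g) (Icc (0:ℝ) 1) := hprim.congr fun y hy => hrep y hy
  refine ⟨hcont, hgc, hasDerivWithinAt_Ioi_of_integral_repr hgc hrep, fun y hy => (hg.hasDeriv y hy).neg,
    hg.memLp.neg, tailPrim_one g, by rw [hg1, neg_zero]⟩

/-- **The glued corollary for K6**: for a sign-admissible triple, a one-sided kinked profile `g` (right piece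
`tailPrim g, −g, −g′`) and ANY left piece `S_L` on `[−1,0]` given with continuous `S_L, S_L′, S_L″`, integral
representations («FTC lines»), clamps at `−1` and `C¹` matching `S_L(0) = ∫₀¹ g`, `S_L′(0) = −g(0)`:
`0 ≤ T_b^{[−1,0]}(S_L) + T_b^{[0,1]}(tailPrim g)`. (With K1 `formDet_shiftRecipe_eq_bulk_add_freeEnd` and K2's
`c₀·T^{[−1,0]}(S_L) = freeEnd_b(∫g, −g(0))` this is `(π/2)·𝔅_{R(b)}(g) ≥ 0`.)
[cite: Zhang2022LandauSiegel, Prop 7.1 p.44 with (7.2), (8.11)–(8.23)] -/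
theorem bulkFormOn_doubled_nonneg_of_kinked (h : SignAdmissible b) (hg : KinkedProfile g g') (hg1 : g 1 = 0)
    {SL SL' SL'' : ℝ → ℂ} (hSL : ContinuousOn SL (Icc (-1:ℝ) 0)) (hSL' : ContinuousOn SL' (Icc (-1:ℝ) 0))
    (hSL'' : ContinuousOn SL'' (Icc (-1:ℝ) 0))
    (hF1 : ∀ y ∈ Icc (-1:ℝ) 0, SL y = SL (-1) + ∫ t in (-1:ℝ)..y, SL' t)
    (hF2 : ∀ y ∈ Icc (-1:ℝ) 0, SL' y = SL' (-1) + ∫ t in (-1:ℝ)..y, SL'' t)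
    (h0 : SL (-1) = 0) (h0' : SL' (-1) = 0)
    (hm0 : SL 0 = ∫ t in (0:ℝ)..1, g t) (hm1 : SL' 0 = -g 0) :
    0 ≤ bulkFormOn b (-1) 0 SL SL' SL'' + bulkFormOn b 0 1 (tailPrim g) (fun y => -g y) (fun y => -g' y) := by
  obtain ⟨hc, hc', hd1, hd2, hm, hcl, hcl'⟩ := rightPiece_of_kinked hg hg1
  exact bulkFormOn_two_piece_nonneg_of_signAdmissible h hSL hSL'
    (hasDerivWithinAt_Ioi_of_integral_repr hSL' hF1) (hasDerivWithinAt_Ioi_of_integral_repr hSL'' hF2)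
    (memLp_two_of_continuousOn_Icc' hSL'') hc hc' hd1 hd2 hm h0 h0' hcl hcl'
    (by rw [hm0, tailPrim_zero]) hm1

end RightPiece

/-! ### Part 7 — Parseval on the circle with finitely many kinks (appended 2026-08-27, [K3′])

One function `S` on a period cell `[c, c+2]` (any base point `c`), `S, S′` continuous on the closed cell,
right-derivatives `S → S′ → S″` at every interior point OUTSIDE a finite exceptional set `N` (the nodes where
pieces are glued), `S″ ∈ L²`, and PERIODIC `C¹` matching `S(c) = S(c+2)`, `S′(c) = S′(c+2)` (no clamps):
`T_b^{[c,c+2]}(S) = (π⁴/2)·Σ_m p_b(m)·|∫_c^{c+2} S e^{−iπm·}|²`, hence `≥ 0` when `p_b ≥ 0` on `ℤ`. The boundary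
terms of the integrations by parts telescope at the nodes (S is single-valued there) and cancel at the wrap
point by periodicity (`k_m(c+2) = k_m(c)`). This subsumes Part 5 (`N = {0}`, clamps) and is the Parseval input
of the TWO-SIDED doubling identity (ls-num-2 g4 2026-08-27T02:24:31Z, Id-5: `S̃` on `[0,2]` glued from four
pieces at `N = {t₁, 1−t₂, 1}`). -/

section Circle

/-- The kernel is `2`-periodic: `k_m(c+2) = k_m(c)`. [cite: Zhang2022LandauSiegel, Prop 7.1 p.44 with (7.2), (8.11)–(8.23)] -/
theorem dker_add_two (m : ℤ) (c : ℝ) :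
    cexp (-(I * π * m * (((c + 2 : ℝ)) : ℂ))) = cexp (-(I * π * m * ((c : ℝ) : ℂ))) := by
  rw [Complex.exp_eq_exp_iff_exists_int]
  refine ⟨-m, ?_⟩
  push_cast
  ring

/-- The per-piece transform is additive over adjacent intervals (integrable data).
[cite: Zhang2022LandauSiegel, Prop 7.1 p.44 with (7.2), (8.11)–(8.23)] -/
theorem dpiece_add_adjacent {a x d : ℝ} {F : ℝ → ℂ} (h1 : IntervalIntegrable F volume a x)
    (h2 : IntervalIntegrable F volume x d) (m : ℤ) :
    dpiece a d F m = dpiece a x F m + dpiece x d F m := by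
  have kcont : Continuous fun y : ℝ => cexp (-(I * π * m * y)) := by fun_prop
  unfold dpiece
  rw [← intervalIntegral.integral_add_adjacent_intervals (h1.mul_continuousOn kcont.continuousOn)
    (h2.mul_continuousOn kcont.continuousOn)]

/-- **Integration by parts with finitely many exceptional points**: for `S` continuous on `[a,d]`, `S′` interval
integrable, and right-derivative `S′(y)` at every `y ∈ (a,d)` outside a finite set `N`:
`∫_a^d S′k_m = S(d)k_m(d) − S(a)k_m(a) + iπm·∫_a^d S k_m` (induction on `N`, splitting at the nodes; the
boundary terms telescope). [cite: Zhang2022LandauSiegel, Prop 7.1 p.44 with (7.2), (8.11)–(8.23)] -/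
theorem dpiece_deriv_of_finset (N : Finset ℝ) :
    ∀ {a d : ℝ}, a ≤ d → ∀ {S S' : ℝ → ℂ}, ContinuousOn S (Icc a d) →
      (∀ y ∈ Ioo a d, y ∉ N → HasDerivWithinAt S (S' y) (Ioi y) y) →
      IntervalIntegrable S' volume a d → ∀ m : ℤ,
      dpiece a d S' m = S d * cexp (-(I * π * m * (d : ℂ))) - S a * cexp (-(I * π * m * (a : ℂ)))
        + I * π * m * dpiece a d S m := by
  induction N using Finset.induction_on with
  | empty =>
    intro a d had S S' hS hder hS'i m
    exact dpiece_deriv had hS (fun y hy => hder y hy (by simp)) hS'i m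
  | insert x N hx ih =>
    intro a d had S S' hS hder hS'i m
    by_cases hxI : x ∈ Ioo a d
    · -- split at the node x
      have hderL : ∀ y ∈ Ioo a x, y ∉ N → HasDerivWithinAt S (S' y) (Ioi y) y := by
        intro y hy hyN
        refine hder y ⟨hy.1, hy.2.trans hxI.2⟩ ?_
        rw [Finset.mem_insert]
        rintro (h | h)
        · exact absurd h hy.2.ne
        · exact hyN h
      have hderR : ∀ y ∈ Ioo x d, y ∉ N → HasDerivWithinAt S (S' y) (Ioi y) y := by
        intro y hy hyN
        refine hder y ⟨hxI.1.trans hy.1, hy.2⟩ ?_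
        rw [Finset.mem_insert]
        rintro (h | h)
        · exact absurd h hy.1.ne'
        · exact hyN h
      have hsubL : uIcc a x ⊆ uIcc a d := by
        rw [uIcc_of_le had, uIcc_of_le hxI.1.le]; exact Icc_subset_Icc_right hxI.2.le
      have hsubR : uIcc x d ⊆ uIcc a d := by
        rw [uIcc_of_le had, uIcc_of_le hxI.2.le]; exact Icc_subset_Icc_left hxI.1.le
      have hL := ih hxI.1.le (hS.mono (Icc_subset_Icc_right hxI.2.le)) hderL (hS'i.mono_set hsubL) m
      have hR := ih hxI.2.le (hS.mono (Icc_subset_Icc_left hxI.1.le)) hderR (hS'i.mono_set hsubR) m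
      have hSi : IntervalIntegrable S volume a d := hS.intervalIntegrable_of_Icc had
      rw [dpiece_add_adjacent (hS'i.mono_set hsubL) (hS'i.mono_set hsubR),
        dpiece_add_adjacent (hSi.mono_set hsubL) (hSi.mono_set hsubR), hL, hR]
      ring
    · -- the new node is outside the open interval: nothing to split
      refine ih had hS (fun y hy hyN => hder y hy ?_) hS'i m
      rw [Finset.mem_insert]
      rintro (h | h)
      · exact hxI (h ▸ hy)
      · exact hyN h

/-- The period cell `(c, c+2]`. [cite: Zhang2022LandauSiegel, Prop 7.1 p.44 with (7.2), (8.11)–(8.23)] -/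
theorem cell_lt' (c : ℝ) : c < c + 2 := lt_add_of_pos_right c two_pos

/-- Mathlib's coefficient on the cell `(c, c+2]` is half the cell transform.
[cite: Zhang2022LandauSiegel, Prop 7.1 p.44 with (7.2), (8.11)–(8.23)] -/
theorem fourierCoeffOn_cell_eq' (c : ℝ) (F : ℝ → ℂ) (m : ℤ) :
    fourierCoeffOn (cell_lt' c) F m = (1 / 2 : ℂ) * dpiece c (c + 2) F m := by
  rw [fourierCoeffOn_eq_integral, dpiece]
  have hT : c + 2 - c = 2 := by ring
  rw [hT]
  simp only [smul_eq_mul, Complex.real_smul]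
  rw [← intervalIntegral.integral_const_mul, ← intervalIntegral.integral_const_mul]
  refine intervalIntegral.integral_congr fun y _ => ?_
  simp only [fourier_coe_apply]
  push_cast
  ring_nf

/-- **Polarised Parseval on the period cell `(c, c+2]`, `MemLp` shape**:
`Σ_m conj D_f(m)·D_g(m) = 2·∫_c^{c+2} conj f·g`, `D_f(m) = ∫_c^{c+2} f e^{−iπm·}`
(from `Literature.Analysis.Fourier.hasSum_conj_fourierCoeffOn_mul`, [Katznelson2004, Ch. I §5]).
[cite: Zhang2022LandauSiegel, Prop 7.1 p.44 with (7.2), (8.11)–(8.23)] -/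
theorem hasSum_conj_dpiece_cell_mul (c : ℝ) {f g : ℝ → ℂ} (hf : MemLp f 2 (volume.restrict (Ioc c (c + 2))))
    (hg : MemLp g 2 (volume.restrict (Ioc c (c + 2)))) :
    HasSum (fun m : ℤ => conj (dpiece c (c + 2) f m) * dpiece c (c + 2) g m)
      (2 * ∫ y in c..c + 2, conj (f y) * g y) := by
  have key := Literature.Analysis.Fourier.hasSum_conj_fourierCoeffOn_mul (c := c) two_pos hf hg
  simp only [fourierCoeffOn_cell_eq', map_mul, map_div₀, map_one] at key
  have h2 : conj (2 : ℂ) = 2 := by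
    rw [show (2 : ℂ) = ((2 : ℝ) : ℂ) by norm_num, Complex.conj_ofReal]
  simp only [h2] at key
  have key4 := key.mul_left (4 : ℂ)
  have hfun : (fun m : ℤ => (4 : ℂ) * (1 / 2 * conj (dpiece c (c + 2) f m) * (1 / 2 * dpiece c (c + 2) g m)))
      = fun m : ℤ => conj (dpiece c (c + 2) f m) * dpiece c (c + 2) g m := by
    funext m; ring
  have hval : (4 : ℂ) * ((2 : ℝ)⁻¹ • ∫ y in c..c + 2, conj (f y) * g y) = 2 * ∫ y in c..c + 2, conj (f y) * g y := by
    rw [Complex.real_smul]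
    push_cast
    ring
  rw [hfun, hval] at key4
  exact key4

variable {S S' S'' : ℝ → ℂ}

/-- The periodic derivative rule on the cell with finitely many kinks: `D_{S′}(m) = iπm·D_S(m)`.
[cite: Zhang2022LandauSiegel, Prop 7.1 p.44 with (7.2), (8.11)–(8.23)] -/
theorem dcell_deriv (c : ℝ) (N : Finset ℝ) {S S' : ℝ → ℂ} (hS : ContinuousOn S (Icc c (c + 2)))
    (hder : ∀ y ∈ Ioo c (c + 2), y ∉ N → HasDerivWithinAt S (S' y) (Ioi y) y)
    (hS'i : IntervalIntegrable S' volume c (c + 2)) (hper : S c = S (c + 2)) (m : ℤ) :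
    dpiece c (c + 2) S' m = I * π * m * dpiece c (c + 2) S m := by
  rw [dpiece_deriv_of_finset N (cell_lt' c).le hS hder hS'i m, hper]
  have hk := dker_add_two m c
  push_cast at hk ⊢
  rw [hk]
  ring

/-- The four lattice summands on the cell. [cite: Zhang2022LandauSiegel, Prop 7.1 p.44 with (7.2), (8.11)–(8.23)] -/
private theorem cell_pairing_terms (c : ℝ) (N : Finset ℝ) (hS : ContinuousOn S (Icc c (c + 2)))
    (hS' : ContinuousOn S' (Icc c (c + 2)))
    (h1 : ∀ y ∈ Ioo c (c + 2), y ∉ N → HasDerivWithinAt S (S' y) (Ioi y) y)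
    (h2 : ∀ y ∈ Ioo c (c + 2), y ∉ N → HasDerivWithinAt S' (S'' y) (Ioi y) y)
    (hS''m : MemLp S'' 2 (volume.restrict (Ioc c (c + 2)))) (hp0 : S c = S (c + 2)) (hp1 : S' c = S' (c + 2))
    (m : ℤ) :
    let D : ℂ := dpiece c (c + 2) S m
    let D' : ℂ := dpiece c (c + 2) S' m
    let D'' : ℂ := dpiece c (c + 2) S'' m
    conj D'' * D'' = (((π ^ 4 * (m : ℝ) ^ 4 * ‖D‖ ^ 2 : ℝ)) : ℂ)
    ∧ conj D' * D'' = I * ((((π ^ 3 * (m : ℝ) ^ 3 * ‖D‖ ^ 2) : ℝ)) : ℂ)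
    ∧ conj D' * D' = (((π ^ 2 * (m : ℝ) ^ 2 * ‖D‖ ^ 2 : ℝ)) : ℂ)
    ∧ conj D * D' = I * ((((π * (m : ℝ) * ‖D‖ ^ 2) : ℝ)) : ℂ) := by
  intro D D' D''
  have hle := (cell_lt' c).le
  have hd1 : D' = I * π * (m : ℂ) * D := dcell_deriv c N hS h1 (hS'.intervalIntegrable_of_Icc hle) hp0 m
  have hd2 : D'' = I * π * (m : ℂ) * D' :=
    dcell_deriv c N hS' h2 (intervalIntegrable_of_memLp_Ioc hle hS''m) hp1 m
  have hsq' : conj D * D = ((‖D‖ : ℂ)) ^ 2 := by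
    rw [Complex.conj_mul']
  have hI : I * I = -1 := Complex.I_mul_I
  refine ⟨?_, ?_, ?_, ?_⟩
  · rw [hd2, hd1]
    simp only [map_mul, Complex.conj_I, Complex.conj_ofReal, map_intCast]
    push_cast
    linear_combination ((π : ℂ) ^ 4 * (m : ℂ) ^ 4 * I ^ 4) * hsq'
      + ((π : ℂ) ^ 4 * (m : ℂ) ^ 4 * ((‖D‖ : ℂ)) ^ 2 * (I * I - 1)) * hI
  · rw [hd2, hd1]
    simp only [map_mul, Complex.conj_I, Complex.conj_ofReal, map_intCast]
    push_cast
    linear_combination (-(I ^ 3) * (π : ℂ) ^ 3 * (m : ℂ) ^ 3) * hsq'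
      + (-(I * (π : ℂ) ^ 3 * (m : ℂ) ^ 3 * ((‖D‖ : ℂ)) ^ 2)) * hI
  · rw [hd1]
    simp only [map_mul, Complex.conj_I, Complex.conj_ofReal, map_intCast]
    push_cast
    linear_combination (-(I ^ 2) * (π : ℂ) ^ 2 * (m : ℂ) ^ 2) * hsq'
      + (-((π : ℂ) ^ 2 * (m : ℂ) ^ 2 * ((‖D‖ : ℂ)) ^ 2)) * hI
  · rw [hd1]
    push_cast
    linear_combination (I * (π : ℂ) * (m : ℂ)) * hsq'

/-- **[K3′] Parseval on the circle with finitely many kinks — the diagonalisation.** For `S, S′` continuous on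
`[c, c+2]`, right-derivatives `S → S′ → S″` on `(c, c+2)` outside a finite set `N`, `S″ ∈ L²(c, c+2]`, and periodic
`C¹` matching `S(c) = S(c+2)`, `S′(c) = S′(c+2)`:
`HasSum (m ↦ (π⁴/2)·(m⁴ + e₁m³ + e₂m² + e₃m)·|∫_c^{c+2} S e^{−iπm·}|²) (T_b^{[c,c+2]}(S))`.
[cite: Zhang2022LandauSiegel, Prop 7.1 p.44 with (7.2), (8.11)–(8.23)] -/
theorem hasSum_bulkFormOn_circle (b : Fin 3 → ℝ) (c : ℝ) (N : Finset ℝ) (hS : ContinuousOn S (Icc c (c + 2)))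
    (hS' : ContinuousOn S' (Icc c (c + 2)))
    (h1 : ∀ y ∈ Ioo c (c + 2), y ∉ N → HasDerivWithinAt S (S' y) (Ioi y) y)
    (h2 : ∀ y ∈ Ioo c (c + 2), y ∉ N → HasDerivWithinAt S' (S'' y) (Ioi y) y)
    (hS''m : MemLp S'' 2 (volume.restrict (Ioc c (c + 2)))) (hp0 : S c = S (c + 2)) (hp1 : S' c = S' (c + 2)) :
    HasSum (fun m : ℤ => π ^ 4 / 2 *
        (((m : ℝ) ^ 4 + (b 0 + b 1 + b 2) * (m : ℝ) ^ 3 + (b 0 * b 1 + b 1 * b 2 + b 2 * b 0) * (m : ℝ) ^ 2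
          + (b 0 * b 1 * b 2) * (m : ℝ)) * ‖dpiece c (c + 2) S m‖ ^ 2))
      (bulkFormOn b c (c + 2) S S' S'') := by
  have mS : MemLp S 2 (volume.restrict (Ioc c (c + 2))) := memLp_two_of_continuousOn_Icc' hS
  have mS' : MemLp S' 2 (volume.restrict (Ioc c (c + 2))) := memLp_two_of_continuousOn_Icc' hS'
  have hA := hasSum_conj_dpiece_cell_mul c hS''m hS''m
  have hB := hasSum_conj_dpiece_cell_mul c mS' hS''m
  have hC := hasSum_conj_dpiece_cell_mul c mS' mS'
  have hD := hasSum_conj_dpiece_cell_mul c mS mS'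
  have tt := fun m => cell_pairing_terms c N hS hS' h1 h2 hS''m hp0 hp1 m
  have tA : (fun m : ℤ => conj (dpiece c (c + 2) S'' m) * dpiece c (c + 2) S'' m)
      = fun m : ℤ => (((π ^ 4 * (m : ℝ) ^ 4 * ‖dpiece c (c + 2) S m‖ ^ 2 : ℝ)) : ℂ) :=
    funext fun m => (tt m).1
  have tB : (fun m : ℤ => conj (dpiece c (c + 2) S' m) * dpiece c (c + 2) S'' m)
      = fun m : ℤ => I * ((((π ^ 3 * (m : ℝ) ^ 3 * ‖dpiece c (c + 2) S m‖ ^ 2) : ℝ)) : ℂ) :=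
    funext fun m => (tt m).2.1
  have tC : (fun m : ℤ => conj (dpiece c (c + 2) S' m) * dpiece c (c + 2) S' m)
      = fun m : ℤ => (((π ^ 2 * (m : ℝ) ^ 2 * ‖dpiece c (c + 2) S m‖ ^ 2 : ℝ)) : ℂ) :=
    funext fun m => (tt m).2.2.1
  have tD : (fun m : ℤ => conj (dpiece c (c + 2) S m) * dpiece c (c + 2) S' m)
      = fun m : ℤ => I * ((((π * (m : ℝ) * ‖dpiece c (c + 2) S m‖ ^ 2) : ℝ)) : ℂ) :=
    funext fun m => (tt m).2.2.2
  rw [tA] at hA; rw [tB] at hB; rw [tC] at hC; rw [tD] at hD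
  have rA : HasSum (fun m : ℤ => π ^ 4 * (m : ℝ) ^ 4 * ‖dpiece c (c + 2) S m‖ ^ 2)
      (2 * ∫ y in c..c + 2, conj (S'' y) * S'' y).re := by
    have := Complex.hasSum_re hA
    simpa only [Complex.ofReal_re] using this
  have iB : HasSum (fun m : ℤ => π ^ 3 * (m : ℝ) ^ 3 * ‖dpiece c (c + 2) S m‖ ^ 2)
      (2 * ∫ y in c..c + 2, conj (S' y) * S'' y).im := by
    have := Complex.hasSum_im hB
    simpa only [Complex.I_mul_im, Complex.ofReal_re] using this
  have rC : HasSum (fun m : ℤ => π ^ 2 * (m : ℝ) ^ 2 * ‖dpiece c (c + 2) S m‖ ^ 2)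
      (2 * ∫ y in c..c + 2, conj (S' y) * S' y).re := by
    have := Complex.hasSum_re hC
    simpa only [Complex.ofReal_re] using this
  have iD : HasSum (fun m : ℤ => π * (m : ℝ) * ‖dpiece c (c + 2) S m‖ ^ 2)
      (2 * ∫ y in c..c + 2, conj (S y) * S' y).im := by
    have := Complex.hasSum_im hD
    simpa only [Complex.I_mul_im, Complex.ofReal_re] using this
  set e1 : ℝ := b 0 + b 1 + b 2 with he1
  set e2 : ℝ := b 0 * b 1 + b 1 * b 2 + b 2 * b 0 with he2
  set e3 : ℝ := b 0 * b 1 * b 2 with he3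
  have goal := ((rA.mul_left (1 / 2 : ℝ)).add ((iB.mul_left (π * e1 / 2)).add
    ((rC.mul_left (π ^ 2 * e2 / 2)).add (iD.mul_left (π ^ 3 * e3 / 2)))))
  have hfun : (fun m : ℤ => 1 / 2 * (π ^ 4 * (m : ℝ) ^ 4 * ‖dpiece c (c + 2) S m‖ ^ 2)
      + (π * e1 / 2 * (π ^ 3 * (m : ℝ) ^ 3 * ‖dpiece c (c + 2) S m‖ ^ 2)
        + (π ^ 2 * e2 / 2 * (π ^ 2 * (m : ℝ) ^ 2 * ‖dpiece c (c + 2) S m‖ ^ 2)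
          + π ^ 3 * e3 / 2 * (π * (m : ℝ) * ‖dpiece c (c + 2) S m‖ ^ 2))))
      = fun m : ℤ => π ^ 4 / 2 *
        (((m : ℝ) ^ 4 + e1 * (m : ℝ) ^ 3 + e2 * (m : ℝ) ^ 2 + e3 * (m : ℝ)) * ‖dpiece c (c + 2) S m‖ ^ 2) := by
    funext m; ring
  have hval : bulkFormOn b c (c + 2) S S' S''
      = 1 / 2 * (2 * ∫ y in c..c + 2, conj (S'' y) * S'' y).re
        + (π * e1 / 2 * (2 * ∫ y in c..c + 2, conj (S' y) * S'' y).im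
          + (π ^ 2 * e2 / 2 * (2 * ∫ y in c..c + 2, conj (S' y) * S' y).re
            + π ^ 3 * e3 / 2 * (2 * ∫ y in c..c + 2, conj (S y) * S' y).im)) := by
    rw [bulkFormOn_eq_pairings b (cell_lt' c).le hS hS' hS''m]
    simp only [← he1, ← he2, ← he3, Complex.mul_re, Complex.mul_im, Complex.re_ofNat, Complex.im_ofNat,
      zero_mul, sub_zero, add_zero]
    ring
  rw [hfun, ← hval] at goal
  exact goal

/-- **The bulk form is additive over adjacent intervals**: for `S, S′` continuous on `[a,d]`, `S″ ∈ L²(a,d]` and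
`x ∈ [a,d]`, `T_b^{[a,d]}(S) = T_b^{[a,x]}(S) + T_b^{[x,d]}(S)` (so a consumer who glues pieces into one function
reads off the per-piece bulk forms). [cite: Zhang2022LandauSiegel, Prop 7.1 p.44 with (7.2), (8.11)–(8.23)] -/
theorem bulkFormOn_add_adjacent (b : Fin 3 → ℝ) {a x d : ℝ} (hx : x ∈ Icc a d) (hS : ContinuousOn S (Icc a d))
    (hS' : ContinuousOn S' (Icc a d)) (hS''m : MemLp S'' 2 (volume.restrict (Ioc a d))) :
    bulkFormOn b a d S S' S'' = bulkFormOn b a x S S' S'' + bulkFormOn b x d S S' S'' := by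
  have hle : a ≤ d := hx.1.trans hx.2
  have iB : IntervalIntegrable (fun y => conj (S' y) * S'' y) volume a d :=
    intervalIntegrable_conj_mul_of_continuousOn_of_memLp' hle hS' hS''m
  have rA : IntervalIntegrable (fun y => ‖S'' y‖ ^ 2) volume a d := by
    rw [intervalIntegrable_iff_integrableOn_Ioc_of_le hle]
    exact (memLp_two_iff_integrable_sq_norm hS''m.1).1 hS''m
  have rB : IntervalIntegrable (fun y => π * (b 0 + b 1 + b 2) * (S'' y * conj (S' y)).im) volume a d := by
    have h1 : IntervalIntegrable (fun y => (conj (S' y) * S'' y).im) volume a d := by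
      rw [intervalIntegrable_iff_integrableOn_Ioc_of_le hle] at iB ⊢
      exact iB.im
    exact (h1.congr fun y _ => by simp only [mul_comm]).const_mul _
  have rC : IntervalIntegrable (fun y => π ^ 2 * (b 0 * b 1 + b 1 * b 2 + b 2 * b 0) * ‖S' y‖ ^ 2) volume a d := by
    have : ContinuousOn (fun y => ‖S' y‖ ^ 2) (Icc a d) := (hS'.norm).pow 2
    exact (this.intervalIntegrable_of_Icc hle).const_mul _
  have rD : IntervalIntegrable (fun y => π ^ 3 * (b 0 * b 1 * b 2) * (S' y * conj (S y)).im) volume a d := by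
    have : ContinuousOn (fun y => (S' y * conj (S y)).im) (Icc a d) :=
      Complex.continuous_im.comp_continuousOn (hS'.mul (Complex.continuous_conj.comp_continuousOn hS))
    exact (this.intervalIntegrable_of_Icc hle).const_mul _
  have hint := ((rA.add rB).add rC).add rD
  have hsubL : uIcc a x ⊆ uIcc a d := by
    rw [uIcc_of_le hle, uIcc_of_le hx.1]; exact Icc_subset_Icc_right hx.2
  have hsubR : uIcc x d ⊆ uIcc a d := by
    rw [uIcc_of_le hle, uIcc_of_le hx.2]; exact Icc_subset_Icc_left hx.1
  rw [bulkFormOn, bulkFormOn, bulkFormOn,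
    ← intervalIntegral.integral_add_adjacent_intervals (hint.mono_set hsubL) (hint.mono_set hsubR)]

/-- **The [K3′] statement shape**: for every base point `c`, finite node set `N` and datum as in
`hasSum_bulkFormOn_circle`, `p_b ≥ 0` on `ℤ` (`∀ m, 0 ≤ bulkSymbol b m`) implies `0 ≤ T_b^{[c,c+2]}(S)`.
A `Prop` DEFINED here and PROVED below (`circleBulkNonneg`). [cite: Zhang2022LandauSiegel, Prop 7.1 p.44 with (7.2), (8.11)–(8.23)] -/
def CircleBulkNonneg (b : Fin 3 → ℝ) : Prop :=
  ∀ (c : ℝ) (N : Finset ℝ) (S S' S'' : ℝ → ℂ),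
    ContinuousOn S (Icc c (c + 2)) → ContinuousOn S' (Icc c (c + 2)) →
    (∀ y ∈ Ioo c (c + 2), y ∉ N → HasDerivWithinAt S (S' y) (Ioi y) y) →
    (∀ y ∈ Ioo c (c + 2), y ∉ N → HasDerivWithinAt S' (S'' y) (Ioi y) y) →
    MemLp S'' 2 (volume.restrict (Ioc c (c + 2))) →
    S c = S (c + 2) → S' c = S' (c + 2) →
    (∀ m : ℤ, 0 ≤ bulkSymbol b m) →
    0 ≤ bulkFormOn b c (c + 2) S S' S''

/-- **[K3′] `Det.CircleBulkNonneg b` holds for every real triple `b`.**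
[cite: Zhang2022LandauSiegel, Prop 7.1 p.44 with (7.2), (8.11)–(8.23)] -/
theorem circleBulkNonneg (b : Fin 3 → ℝ) : CircleBulkNonneg b := by
  intro c N S S' S'' hS hS' h1 h2 hS''m hp0 hp1 hlat
  refine (hasSum_bulkFormOn_circle b c N hS hS' h1 h2 hS''m hp0 hp1).nonneg fun m => ?_
  have hσ := hlat m
  rw [bulkSymbol_eq_poly] at hσ
  positivity

/-- `CircleBulkNonneg` holds for all parameters — `_holds` alias of `circleBulkNonneg` above under the fact's exact name
(appended 2026-08-28, D-0026 bookkeeping: the proof term is the existing theorem of this file; no statement,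
definition or attribute is edited; no new named fact; the ledger's debt table listed the fact
unproved). [cite: Zhang2022LandauSiegel, Prop 7.1 p.44 with (7.2), (8.11)–(8.23)] -/
theorem _root_.Literature.NumberTheory.LFunctions.Zhang2022.Det.CircleBulkNonneg_holds
    (b : Fin 3 → ℝ) :
    CircleBulkNonneg b :=
  _root_.Literature.NumberTheory.LFunctions.Zhang2022.Det.circleBulkNonneg b

/-- **For a SIGN-ADMISSIBLE triple the bulk form of a periodic `C¹`, piecewise-`H²` function on any period cell
is `≥ 0`** (K3′ ∘ K4). [cite: Zhang2022LandauSiegel, Prop 7.1 p.44 with (7.2), (8.11)–(8.23)] -/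
theorem bulkFormOn_circle_nonneg_of_signAdmissible (h : SignAdmissible b) (c : ℝ) (N : Finset ℝ)
    (hS : ContinuousOn S (Icc c (c + 2))) (hS' : ContinuousOn S' (Icc c (c + 2)))
    (h1 : ∀ y ∈ Ioo c (c + 2), y ∉ N → HasDerivWithinAt S (S' y) (Ioi y) y)
    (h2 : ∀ y ∈ Ioo c (c + 2), y ∉ N → HasDerivWithinAt S' (S'' y) (Ioi y) y)
    (hS''m : MemLp S'' 2 (volume.restrict (Ioc c (c + 2)))) (hp0 : S c = S (c + 2)) (hp1 : S' c = S' (c + 2)) :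
    0 ≤ bulkFormOn b c (c + 2) S S' S'' :=
  circleBulkNonneg b c N S S' S'' hS hS' h1 h2 hS''m hp0 hp1 h.bulkSymbol_intCast_nonneg

end Circle

end Det

end Literature.NumberTheory.LFunctions.Zhang2022
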